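import Mathlib.Algebra.Module.LocalizedModule.Basic
import Mathlib.RingTheory.Localization.Away.Basic
import Mathlib.RingTheory.Localization.Ideal
import Mathlib.RingTheory.PrincipalIdealDomainOfPrime
import Mathlib.LinearAlgebra.Dimension.Localization
import Mathlib.LinearAlgebra.FreeModule.PID
import Mathlib.RingTheory.Localization.Finiteness
import Literature.NumberTheory.EllipticCurves.HeegnerModuleIndex
import Literature.NumberTheory.EllipticCurves.CyclotomicPAdicHeight
import Literature.NumberTheory.EllipticCurves.IwasawaAlgebraStructureProofs
import Literature.NumberTheory.EllipticCurves.ModifiedTamagawaProductAnticyclotomicSquares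
import HarnessLib

/-!
# The rational anticyclotomic `Λ`-adic Selmer module `𝒮_∞`, its base projections, universal norms
# and `Λ`-adic heights (Howard 2005, §1; Perrin-Riou 1987/1992; Bertolini 1995)

Definition request `defn-anticyclotomicCompactSelmer` (topic `NumberTheory/EllipticCurves`; crux-plan
line `lambda-adic-gz-square-class` of `PAdicOrderThesisR2`). Setting: `E/ℚ` (model `W`), `p` a prime,
`K` a number field (an imaginary quadratic field in every application), `K_∞/K` a `ℤ_p`-extension
`κ : ZpExtension K p` (the anticyclotomic one in every application, `κ.IsAnticyclotomic`) with layers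
`K_s = κ.layer s` cut out by `κ.layerSubgroup s = Gal(K̄/K_s) ≤ Γ_K`, `γ` a topological generator of
`Gal(K_∞/K)` and `Λ = ℤ_p⟦T⟧` (`IwasawaAlgebra p`, `T ↦ γ - 1`). Howard, *The Iwasawa theoretic
Gross–Zagier theorem*, Compositio 141 (2005), §1 (held: `paper:arxiv-1202.6349`, p. 5 of the TeX):

> "Define `Λ_anti = ℤ_p⟦Gal(K_∞/K)⟧ ⊗ ℚ_p`, and `𝒮(K_s, E) = lim←_k Sel_{p^k}(K_s, E)`,
> `𝒮_∞ = (lim←_s 𝒮(K_s, E)) ⊗ ℚ_p` […] It is known by work of Bertolini and the author that […]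
> `𝒮_∞` is free of rank one […] **Proposition 1.0.4** (Perrin-Riou). There is a `p`-adic height pairing
> `𝔥_s : 𝒮(K_s, E) × 𝒮(K_s, E) → c⁻¹ℤ_p` whose restriction to the image of the Kummer map
> `E(K_s) ⊗ ℤ_p → 𝒮(K_s, E)` agrees with the pairing `⟨ , ⟩_{E,K_s}` […] where `c ∈ ℤ_p` is independent
> of `s`. There is a `Λ_anti`-adic height pairing `𝔥_∞ : 𝒮_∞ × 𝒮_∞ → Λ_anti` defined by
> `𝔥_∞(lim← a_s, lim← b_s) = lim← ∑_{σ ∈ Gal(K_s/K)} 𝔥_s(a_s, b_s^σ) · σ`, and we define the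
> `Λ_anti`-adic regulator `ℛ` to be the image of this map."

Everything *integral* is already in the tree (file `HeegnerModuleIndex`): the compact Selmer groups
`𝒮(K_s, E) = S_p(E/K_s) = WeierstrassCurve.compactSelmerOver W p (κ.layerSubgroup s)` (a genuine
subgroup of `∏_k H¹(Gal(K̄/K_s), E[p^k])`, Perrin-Riou 1987, §0) and the `Λ`-module
`lim←_s S_p(E/K_s)` as the hypothesis structure `WeierstrassCurve.LambdaAdicSelmerData W κ γ` (an
abstract `Λ`-module `D.S` with projections `D.proj s` pinned down by identities). This file adds the
**rational** objects of Howard's §1 on top of a datum `D`: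

1. `Literature.NumberTheory.EllipticCurves.ratIwasawaAlgebra p` — **`Λ_ℚ = Λ[1/p] = Λ ⊗_{ℤ_p} ℚ_p`**
   (`ℚ_p = ℤ_p[1/p]`), Mathlib's `Localization` at the powers of `p ∈ Λ`; through `γ ↦ 1 + T` this
   is Howard's `Λ_anti` (for `κ` anticyclotomic).
2. `D.SInfty` — **`𝒮_∞ = (lim←_s S_p(E/K_s)) ⊗ ℚ_p = D.S[1/p]`**, Mathlib's `LocalizedModule`, a module
   over `Λ_ℚ` and over `Λ` (instances from Mathlib), with the map `D.toSInfty : D.S → 𝒮_∞`. It is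
   also the localisation of the abelian group `D.S` at the powers of `p ∈ ℤ`
   (`isLocalizedModule_toSInftyInt`), which is how maps out of it are built.
3. The finite levels rationalised: `W.ratTorsionH1Pi p H = ℚ ⊗_ℤ ∏_k H¹(H, E[p^k])` (for a
   `ℤ_p`-module `A`, `A ⊗_{ℤ_p} ℚ_p = A ⊗_ℤ ℚ` as a group), the subspace
   `W.ratCompactSelmerOver p H = S_p(E/L) ⊗ ℚ_p` (`L = K̄^H`), and the **base projections**
   `D.projInfty s : 𝒮_∞ → S_p(E/K_s) ⊗ ℚ_p` (the control maps `pr_s`; `pr_0` is the requested base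
   projection), with `projInfty_toSInfty`, `projInfty_mem`.
4. **Universal norms**: `D.universalNormSubspace s`, the `ℚ`-span of `pr_s(𝒮_∞)` inside
   `S_p(E/K_s) ⊗ ℚ_p` (`universalNormSubspace_le`). When `𝒮_∞ = Λ_ℚ · g` is free of rank one
   (`Howard2005_SInfty_free`), `pr_0(f · g) = f(0) · pr_0(g)` (`T = γ - 1` acts as `0` on
   `H¹(K, ·)`), so `universalNormSubspace D 0 = ℚ_p · pr_0(g)` is the "shadow line" `ℓ_K` of
   Balakrishnan–Çiperiani–Mazur–Rubin (the line of universal norms), typed without choosing `g`.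
5. **Kummer images**: `W.IsKummerFamilyOver p H hP d` (the family `d = (δ_L(P) ∈ H¹(H, E[p^k]))_k` of
   Kummer classes of an `H`-fixed geometric point `P`, through the tree's `kummerClassOver` at all
   `p^k`-th roots, as in `heegnerModuleLayer`), the `ℚ_p`-subspace `W.kummerRatSpan p H S hS` of
   `S_p(E/L) ⊗ ℚ_p`-ambient spanned by the Kummer families of a set `S` of `H`-fixed points, the
   points of the layers inside `E(K̄)` (`W.layerPoints κ s : E(K_s) → E(K̄)`, `smul_layerPoints`), and
   at level `0` (`κ.layerSubgroup 0 = Γ_K`): `W.mordellWeilRatSubspace p κ = E(K) ⊗ ℚ_p` and, for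
   `E/ℚ`, `W.rationalPointsRatSubspace K p κ = E(ℚ) ⊗ ℚ_p` (through `toGeomPoints`,
   `pointToBaseChange`), with the predicates `D.HasMordellWeilUniversalNorms`
   (`pr_0(𝒮_∞) ⊆ E(K) ⊗ ℚ_p`) and `D.HasRationalUniversalNorms` (`pr_0(𝒮_∞) ⊆ E(ℚ) ⊗ ℚ_p`, the
   statement "UNMW(K, p): `ℓ_K ⊂ E(ℚ) ⊗ ℚ_p`" of the requesting line) — predicates on the datum,
   nothing asserted.
6. **`Λ`-adic heights** as a hypothesis structure `LambdaAdicHeightData W D` (Howard's Prop. 1.0.4 is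
   itself an existence statement about Perrin-Riou's pairings, whose construction — Perrin-Riou 1992
   — is far outside the tree): the integral pairings `p^c · 𝔥_s` on `S_p(E/K_s)` (fields
   `pairingLayer`, symmetric, `Γ`-equivariant), `p^c · 𝔥_∞` on `D.S` (field `pairing`) pinned down by
   Howard's defining formula as the congruences
   `p^c 𝔥_∞(a, b) ≡ ∑_{i < p^s} p^c 𝔥_s(pr_s a, γ^i pr_s b) (1+T)^i (mod ω_s)`,
   `ω_s = (1+T)^{p^s} - 1` (`pairing_spec`; `⋂_s ω_s Λ = 0`, so this determines `pairing`), and the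
   normalisation at level `0` on Kummer images by the tree's canonical cyclotomic height of `E/K`
   (`pairingZero_kummer`, `cyclotomicPAdicHeightK`). From it: the genuine
   `𝔥_∞ = H.heightPairing : 𝒮_∞ → 𝒮_∞ → Λ_ℚ` (`p^{-c}` times the extension of `pairing` to the
   localisation, `heightPairing_toSInfty`), Howard's regulator `ℛ = H.regulator`, and the read-off of
   `𝔥_0` on base projections from the constant term of `𝔥_∞` (`constantCoeff_pairing`).
7. **Named facts** (`def … : Prop`, cited): `Howard2005_SInfty_free` (`𝒮_∞` is free of rank one over
   `Λ_ℚ`; Howard 2005 §1 after Bertolini 1995 and Howard 2004, Thm. B) and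
   `Howard2005_exists_lambdaAdicHeightData` (Prop. 1.0.4). Howard's inequality
   `rank_{ℤ_p} S_p(E/K) ≤ 1 + 2 ord_J char(𝒮_∞/ℋ)` (Howard 2004, §1 (2)) is ALREADY the tree's
   `Howard2004_selmerCorank_le` (with `heegnerModuleIndex`); the rational Heegner module and its
   characteristic ideal over `Λ_ℚ` are `ratHeegnerModule`, `ratHeegnerCharIdeal` below.
8. **Complex conjugation at the finite levels** (Part 7; Howard 2004, §2.3: "the automorphism of
   `G_K` given by conjugation by `τ` induce[s] a change of group `(G_K, T) ⇝ (G_K, Tw(T))` which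
   induces an isomorphism on cohomology"): for `K/ℚ` normal and `g ∈ Γ_ℚ`, the continuous *outer*
   automorphism `σ ↦ ĝ⁻¹ σ ĝ` of `Γ_K` (`absGaloisOuterConj K g`, `ĝ = absGaloisTransport g` the
   transport of `g` to `K̄`), its action `ĝ` on `E(K̄)` for `E/ℚ` (`geomPointsOuterConj`), the
   induced map on `H¹(H, E[m])` for a stable `H ≤ Γ_K` (`outerConjH1`, an involution for `g² = 1`),
   and — for `κ` anticyclotomic and `c₀ ∈ Γ_ℚ ∖ res(Γ_K)`, which stabilises every `Gal(K̄/K_s)`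
   (`ZpExtension.absGaloisOuterConj_mem_layerSubgroup_iff`) — the complex conjugation on
   `H¹(K_s, E[m])`, on `∏_k H¹(K_s, E[p^k])` and, `ℚ`-linearly, on `(∏_k H¹(K_s, E[p^k])) ⊗ ℚ`
   (`complexConjLayerH1`, `complexConjLayerPi`, `ratComplexConjLayer`) with its `±`-eigenspaces
   `layerPlusSubspace`, `layerMinusSubspace` (Gross 1991: `E(K) ⊗ ℚ_p = E(K)^+ ⊕ E(K)^-`).

## What is NOT here (and why)

* **Complex conjugation on `𝒮_∞` itself.** Part 7 builds it on every finite level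
  `H¹(Gal(K̄/K_s), E[p^k])`, hence on `S_p(E/K_s) ⊗ ℚ_p`-ambients and on the targets of the base
  projections; transporting it to the abstract `Λ`-module `D.S = lim←_s S_p(E/K_s)` through the
  universal property (`D.surj`, `D.ext`) needs the norm-compatibility of the conjugated family,
  i.e. that inner automorphisms act trivially on `H¹(K_{s+1}, ·)` (the tree's named fact
  `conjH1_of_mem`), and its `ι`-semilinearity; neither is done here (TODO(conjugation on 𝒮_∞)).
  That the conjugation preserves the Selmer conditions (`compactSelmerOver`) is likewise not
  recorded (it permutes the local conditions, cf. `map_conjH1_selmerGroupOver_le`). For the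
  requesting line the `+`-part enters through `E(ℚ) ⊗ ℚ_p ⊆ (E(K) ⊗ ℚ_p)^+`, typed directly by
  `rationalPointsRatSubspace`/`HasRationalUniversalNorms`, or through `layerPlusSubspace … 0`. TODO(conjugation): `Gal(K/ℚ)`-action on `compactSelmerOver`, `ι`-semilinear on `𝒮_∞`.
* **A `ℚ_p`-vector-space structure on `S_p(E/K_s) ⊗ ℚ_p`.** The tree's `H¹(H, E[p^k])` is a bare
  abelian group (Mathlib's continuous cohomology is `ℤ`-linear) and `ℤ_p` acts on `∏_k H¹(H, E[p^k])`
  only through the operators `padicPi` (that `p^k` kills `H¹(H, E[p^k])` is not available), so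
  "`⊗ ℚ_p`" is rendered as `ℚ ⊗_ℤ`, a `ℚ`-vector space, and `ℚ_p`-spans as `ℚ`-spans of
  `padicPi`-multiples (`kummerRatSpan`). On `𝒮_∞` itself the `ℚ_p`-structure is part of the
  `Λ_ℚ`-module structure.
* The involution `ι` of `Λ` and the identity
  `e(ℒ_Heeg)Λ_anti = 𝔥_∞(ỹ_∞, ỹ_∞)Λ_anti = char(𝒮_∞/ℋ)·char(𝒮_∞/ℋ)^ι·ℛ` (Howard 2005, p. 5): the first
  equality relates to the two-variable `p`-adic `L`-function (request `defn-twoVariablePAdicLFunctionK`),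
  the second is linear algebra in a free rank-one module; neither is vendored here. Conventions to
  match there: `b^σ := conj_σ b` (the tree's left action `conjH1`), `σ = γ^i ↦ (1+T)^i`.

## Design notes

* `Λ_ℚ` is `Localization (Submonoid.powers (C p))` rather than `ℚ_[p] ⊗[ℤ_[p]] Λ`: the module
  structure of `D.S[1/p]` over it is a Mathlib instance, and `Λ → Λ_ℚ` is injective
  (`algebraMap_ratIwasawaAlgebra_injective`). `Λ_ℚ = ℤ_p⟦T⟧[1/p]` is a principal ideal domain, so
  "torsion-free of rank one" (Howard 2004, Thm. B, over `Λ`) becomes "free of rank one" after `⊗ ℚ_p`: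
  Part 6 proves `IsPrincipalIdealRing (ratIwasawaAlgebra p)` (the primes of `Λ` avoiding `p` have
  height `≤ 1` and are principal, `IwasawaAlgebra.eq_span_of_height_eq_one`) and derives
  `Howard2005_SInfty_free` from the tree's `Howard2004_thmB` (`Howard2005_SInfty_free_of_thmB`,
  modulo the existence fact `nonempty_selmerDualData` needed to instantiate Thm. B's `X`).
* The hypotheses of the two facts are Howard's at that point of the paper (the hypotheses of his
  Thm. 1 — `D` odd, `D ≠ -3`, `p` split in `K`, `(p, DN) = 1`, `E` ordinary at `p` — together with
  "`Gal(K̄/K)` surjects onto `Aut_{ℤ_p}(T_p E)` and `p ∤ h_K`"), transcribed as the tree's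
  `HowardHypotheses N W K p κ γ` (Howard 2004) plus `Odd d_K` and "`p` splits in `K`"; the level
  `N = N_E` is tied to `E` by a `HeegnerFamily`, exactly as in `Howard2004_thmB`.
* Universe: `K : Type` (universe `0`) in the height and fact sections, forced by `PAdicHeightDataK`
  (file `PAdicHeightsK`); the algebraic sections are universe-polymorphic.
* Mathlib/tree search: `universal norm`, `compact.*Selmer`, `Λ ⊗ ℚ_p`, `Localization.Away` in the
  topic — nothing beyond `HeegnerModuleIndex`; reused: `IwasawaAlgebra.C_natCast_p_ne_zero`, `LambdaAdicSelmerData`, `compactSelmerOver`,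
  `torsionH1Over`, `kummerClassOver`, `padicPi`, `conjPi`, `toGeomPoints`, `pointToBaseChange`,
  `cyclotomicPAdicHeightK`, `HowardHypotheses`, `HeegnerFamily`, `heegnerModule`, `Module.charIdeal`,
  `resH1Hom` (+ `_id`, `_comp`, `_congr`), `absGaloisTransport`, `absGaloisRestrict`,
  `ZpExtension.apply_eq_inv_of_absGaloisRestrict_eq_conj`, `ZpExtension.mem_layerSubgroup_iff_of_apply_eq_inv`,
  Mathlib `LocalizedModule`, `IsLocalizedModule.lift`, `TensorProduct`, `krullTopology_mem_nhds_one_iff`,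
  `AlgEquiv.restrictNormal_commutes`, `Affine.Point.map`.

## References

* [Howard2005] B. Howard, *The Iwasawa theoretic Gross–Zagier theorem*, Compositio Math. 141 (2005),
  811–846 (held: `paper:arxiv-1202.6349`): §1, p. 5 of the TeX (= pp. 814–815): `𝒮(K_s, E)`,
  `𝒮_∞`, `Λ_anti`, `X`, `ℋ`, "`𝒮_∞` is free of rank one", Prop. 1.0.4, `𝔥_∞`, `ℛ`.
* [Howard2004HeegnerKolyvagin] B. Howard, *The Heegner point Kolyvagin system*, Compositio Math. 140
  (2004) (held: `paper:arxiv-1202.6340`): §1 Thm. A, Thm. B, eq. (2).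
* [Bertolini1995] M. Bertolini, *Selmer groups and Heegner points in anticyclotomic
  `ℤ_p`-extensions*, Compositio Math. 99 (1995), 153–182 (parts of Thm. B; universal norms).
* [PerrinRiou1987BSMF] B. Perrin-Riou, Bull. SMF 115 (1987), §0 (`S_p(L)`, `𝔖_p(L)`).
* [PerrinRiou1992] B. Perrin-Riou, *Théorie d'Iwasawa et hauteurs `p`-adiques*, Invent. Math. 109
  (1992) (the pairings `𝔥_s`, `𝔥_∞` of Prop. 1.0.4; Howard's [pr3, pr4]).
* [GrossLMS1991] B. H. Gross, *Kolyvagin's work on modular elliptic curves* (1991), §§1, 4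
  (complex conjugation on `E(K) ⊗ ℚ_p` and on `H¹(K, E_p)`, `±`-eigenspaces).
* [Greenberg1987] R. Greenberg, Progr. Math. 70 (1987), §2 (the anticyclotomic `ℤ_p`-extension is
  Galois over `ℚ`, generalised dihedral).
-/

noncomputable section

open scoped Classical TensorProduct

open NumberField IsDedekindDomain

universe u

/-! ## Part 1. `Λ_ℚ = Λ[1/p] = Λ ⊗_{ℤ_p} ℚ_p` -/

namespace Literature.NumberTheory.EllipticCurves

namespace IwasawaAlgebra

variable (p : ℕ) [Fact p.Prime]

/-- The multiplicative set `{p^n} ⊆ Λ = ℤ_p⟦T⟧` of powers of the constant `p = C p`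
(Mathlib `Submonoid.powers`). [folklore] -/
abbrev pPowers : Submonoid (IwasawaAlgebra p) :=
  Submonoid.powers (PowerSeries.C (p : ℤ_[p]) : IwasawaAlgebra p)

/-- `(C p)^n = p^n` as a natural-number cast in `Λ` (`C` is a ring homomorphism). [folklore] -/
theorem C_p_pow_eq_natCast (n : ℕ) :
    (PowerSeries.C (p : ℤ_[p]) : IwasawaAlgebra p) ^ n = ((p ^ n : ℕ) : IwasawaAlgebra p) := by
  rw [← map_pow, ← map_natCast (PowerSeries.C (R := ℤ_[p])), Nat.cast_pow]

/-- `n ↦ (C p)^n` is injective (`C` is injective and `p ≥ 2`). [folklore] -/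
theorem C_p_pow_injective :
    Function.Injective fun n : ℕ ↦ (PowerSeries.C (p : ℤ_[p]) : IwasawaAlgebra p) ^ n := by
  intro n m h
  simp only [← map_pow] at h
  have h' : ((p : ℤ_[p]) ^ n) = (p : ℤ_[p]) ^ m := PowerSeries.C_injective h
  exact Nat.pow_right_injective (Fact.out : p.Prime).two_le (by exact_mod_cast h')

/-- The powers of `p` are non-zero-divisors of the domain `Λ` (`C p ≠ 0`, the tree's
`IwasawaAlgebra.C_natCast_p_ne_zero`). [folklore] -/
theorem pPowers_le_nonZeroDivisors : pPowers p ≤ nonZeroDivisors (IwasawaAlgebra p) :=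
  powers_le_nonZeroDivisors_of_noZeroDivisors (C_natCast_p_ne_zero p)

end IwasawaAlgebra

variable (p : ℕ) [Fact p.Prime]

/-- **`Λ_ℚ = Λ[1/p] = Λ ⊗_{ℤ_p} ℚ_p`**, the Iwasawa algebra with `p` inverted (Mathlib's `Localization`
of `Λ = ℤ_p⟦T⟧` at the powers of `C p`; since `ℚ_p = ℤ_p[1/p]`, inverting `p` is tensoring with `ℚ_p`
over `ℤ_p`). Through `γ ↦ 1 + T` for a topological generator `γ` of `Gal(K_∞/K)` this is Howard's
`Λ_anti := ℤ_p⟦Gal(K_∞/K)⟧ ⊗ ℚ_p` (Compositio 141, §1, p. 814). A `ℚ_p`-algebra and a principal ideal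
domain (neither fact is recorded here). [cite: Howard2005, §1 (p. 814, definition of Λ_anti)] -/
abbrev ratIwasawaAlgebra : Type :=
  Localization (IwasawaAlgebra.pPowers p)

/-- `Λ → Λ_ℚ` is injective (`Λ` is a domain and `p ≠ 0`; Mathlib `IsLocalization.injective`).
[folklore] -/
theorem algebraMap_ratIwasawaAlgebra_injective :
    Function.Injective (algebraMap (IwasawaAlgebra p) (ratIwasawaAlgebra p)) :=
  IsLocalization.injective (ratIwasawaAlgebra p) (IwasawaAlgebra.pPowers_le_nonZeroDivisors p)

/-- `p^{-n} ∈ Λ_ℚ`: the fraction `1 / (C p)^n`. [folklore] -/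
def ratIwasawaAlgebra.invPPow (n : ℕ) : ratIwasawaAlgebra p :=
  Localization.mk 1 ⟨(PowerSeries.C (p : ℤ_[p]) : IwasawaAlgebra p) ^ n, n, rfl⟩

/-- `p^n · p^{-n} = 1` in `Λ_ℚ`. [folklore] -/
theorem ratIwasawaAlgebra.algebraMap_pow_mul_invPPow (n : ℕ) :
    algebraMap (IwasawaAlgebra p) (ratIwasawaAlgebra p) ((PowerSeries.C (p : ℤ_[p])) ^ n) *
      ratIwasawaAlgebra.invPPow p n = 1 := by
  rw [ratIwasawaAlgebra.invPPow, ← Localization.mk_one_eq_algebraMap, Localization.mk_mul, mul_one,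
    ← Localization.mk_one, Localization.mk_eq_mk_iff]
  exact Localization.r_of_eq (by simp)

/-- On a `Λ_ℚ`-module the integer `p^n` acts invertibly (it acts as the unit `p^n` of `Λ_ℚ`), so
`ℤ`-linear maps into it extend along localisation at `p` (`IsLocalizedModule.lift`). The `ℤ`-module
structure is an arbitrary instance (all agree with the `AddCommGroup` one, `int_smul_eq_zsmul`).
[folklore] -/
theorem isUnit_algebraMap_int_end_of_module (V : Type*) [AddCommGroup V] [Module ℤ V]
    [Module (ratIwasawaAlgebra p) V] (x : Submonoid.powers (p : ℤ)) :
    IsUnit (algebraMap ℤ (Module.End ℤ V) x) := by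
  obtain ⟨n, hn⟩ := (Submonoid.mem_powers_iff _ _).mp x.2
  rw [eq_intCast, ← hn, Int.cast_pow]
  refine IsUnit.pow n ?_
  obtain ⟨u, hu⟩ := IsLocalization.map_units (ratIwasawaAlgebra p)
    (⟨PowerSeries.C (p : ℤ_[p]), Submonoid.mem_powers _⟩ : IwasawaAlgebra.pPowers p)
  have hu' : (u : ratIwasawaAlgebra p) = (p : ratIwasawaAlgebra p) := by
    rw [hu]
    change algebraMap (IwasawaAlgebra p) (ratIwasawaAlgebra p) (PowerSeries.C (p : ℤ_[p])) = _
    rw [map_natCast, map_natCast]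
  have heq : ⇑((p : ℤ) : Module.End ℤ V) = fun v ↦ (u : ratIwasawaAlgebra p) • v := by
    ext v
    rw [Module.End.intCast_apply, ← Int.cast_smul_eq_zsmul (ratIwasawaAlgebra p), Int.cast_natCast,
      hu']
  rw [Module.End.isUnit_iff, heq]
  refine Function.bijective_iff_has_inverse.mpr ⟨fun v ↦ (u⁻¹ : (ratIwasawaAlgebra p)ˣ) • v,
    fun v ↦ ?_, fun v ↦ ?_⟩
  · exact inv_smul_smul u v
  · exact smul_inv_smul u v

/-- On a `ℚ`-vector space the integer `p^n` acts invertibly (any `ℤ`-module instance). [folklore] -/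
theorem isUnit_algebraMap_int_end_of_rat (V : Type*) [AddCommGroup V] [Module ℤ V] [Module ℚ V]
    (x : Submonoid.powers (p : ℤ)) : IsUnit (algebraMap ℤ (Module.End ℤ V) x) := by
  obtain ⟨n, hn⟩ := (Submonoid.mem_powers_iff _ _).mp x.2
  rw [eq_intCast, ← hn, Int.cast_pow]
  refine IsUnit.pow n ?_
  have hp0 : (p : ℚ) ≠ 0 := by exact_mod_cast (Fact.out : p.Prime).ne_zero
  have heq : ⇑((p : ℤ) : Module.End ℤ V) = fun v ↦ (p : ℚ) • v := by
    ext v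
    rw [Module.End.intCast_apply, ← Int.cast_smul_eq_zsmul ℚ, Int.cast_natCast]
  rw [Module.End.isUnit_iff, heq]
  refine Function.bijective_iff_has_inverse.mpr ⟨fun v ↦ (p : ℚ)⁻¹ • v, fun v ↦ ?_, fun v ↦ ?_⟩
  · simp only [smul_smul, inv_mul_cancel₀ hp0, one_smul]
  · simp only [smul_smul, mul_inv_cancel₀ hp0, one_smul]

end Literature.NumberTheory.EllipticCurves

/-! ## Part 2. The finite levels rationalised: `S_p(E/L) ⊗ ℚ_p`, Kummer families -/

namespace WeierstrassCurve

open Literature.NumberTheory.EllipticCurves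

variable {K : Type u} [Field K] (W : WeierstrassCurve K) (p : ℕ)

/-- The ambient group `∏_k H¹(H, E[p^k])` of the compact Selmer group `S_p(E/L) = lim←_k Sel_{p^k}(E/L)`
(`compactSelmerOver`), `L = K̄^H` (the tree's `torsionH1Over` at all `p^k`).
Perrin-Riou 1987, §0, p. 401. [cite: PerrinRiou1987BSMF, §0 p. 401] -/
abbrev torsionH1Pi (H : Subgroup (Field.absoluteGaloisGroup K)) : Type u :=
  Π k : ℕ, W.torsionH1Over ((p : ℤ) ^ k) H

/-- **`(∏_k H¹(H, E[p^k])) ⊗ ℚ`**, the ambient `ℚ`-vector space of `S_p(E/L) ⊗_{ℤ_p} ℚ_p` (for a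
`ℤ_p`-module `A`, `A ⊗_{ℤ_p} ℚ_p = A ⊗_ℤ ℚ` as a group, since `ℚ_p = ℤ_p ⊗_ℤ ℚ`; the `ℚ_p`-structure is
not recorded, see the module docstring). Howard 2005, §1 (`𝒮(K_s, E) ⊗ ℚ_p`, the target of the base
projections of `𝒮_∞`). [cite: Howard2005, §1 (p. 814)] -/
abbrev ratTorsionH1Pi (H : Subgroup (Field.absoluteGaloisGroup K)) : Type u :=
  ℚ ⊗[ℤ] W.torsionH1Pi p H

/-- The map `x ↦ 1 ⊗ x : ∏_k H¹(H, E[p^k]) → (∏_k H¹(H, E[p^k])) ⊗ ℚ` (kernel: the torsion subgroup).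
[folklore] -/
def toRatTorsionH1Pi (H : Subgroup (Field.absoluteGaloisGroup K)) :
    W.torsionH1Pi p H →+ W.ratTorsionH1Pi p H :=
  (TensorProduct.mk ℤ ℚ (W.torsionH1Pi p H) 1).toAddMonoidHom

/-- Unfolding `toRatTorsionH1Pi`: `x ↦ 1 ⊗ₜ x`. [folklore] -/
@[simp]
theorem toRatTorsionH1Pi_apply (H : Subgroup (Field.absoluteGaloisGroup K)) (x : W.torsionH1Pi p H) :
    W.toRatTorsionH1Pi p H x = (1 : ℚ) ⊗ₜ[ℤ] x :=
  rfl

section NumberField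

variable [NumberField K] (H : Subgroup (Field.absoluteGaloisGroup K)) [H.Normal]

/-- **`S_p(E/L) ⊗ ℚ_p`** (`L = K̄^H`): the `ℚ`-subspace of `(∏_k H¹(H, E[p^k])) ⊗ ℚ` spanned by
`1 ⊗ S_p(E/L)` (`compactSelmerOver`; since `S_p(E/L)` is a `ℤ_p`-module this `ℚ`-span is its
`ℚ_p`-span). Howard 2005, §1 (`𝒮(K_s, E) ⊗ ℚ_p`); Howard 2004, §1 (`S_p(E/L)`).
[cite: Howard2005, §1 (p. 814)] -/
def ratCompactSelmerOver : Submodule ℚ (W.ratTorsionH1Pi p H) :=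
  Submodule.span ℚ (W.toRatTorsionH1Pi p H '' (W.compactSelmerOver H p))

/-- `1 ⊗ x ∈ S_p(E/L) ⊗ ℚ_p` for `x ∈ S_p(E/L)`. [folklore] -/
theorem toRatTorsionH1Pi_mem_ratCompactSelmerOver {x : W.torsionH1Pi p H}
    (hx : x ∈ W.compactSelmerOver H p) : W.toRatTorsionH1Pi p H x ∈ W.ratCompactSelmerOver p H :=
  Submodule.subset_span ⟨x, hx, rfl⟩

end NumberField

/-! ### Kummer families and `ℚ_p`-Mordell–Weil subspaces -/

section Kummer

variable [Fact p.Prime] (H : Subgroup (Field.absoluteGaloisGroup K))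

variable {W} in
/-- **Kummer family of an `H`-fixed geometric point.** For `P ∈ E(K̄)` fixed by `H ≤ Γ_K` (i.e.
`P ∈ E(L)`, `L = K̄^H`), the family `d ∈ ∏_k H¹(H, E[p^k])` *is the Kummer family of `P`* when
`d_k = δ_L(P) ∈ H¹(L, E[p^k])` is the Kummer class `[σ ↦ σQ - Q]` for every `p^k`-th root `Q` of `P`
(the tree's `kummerClassOver`; the class does not depend on the root, and roots exist in
characteristic `0`, so this pins `d` down — the same device as `heegnerModuleLayer`). The resulting
`d` lies in `S_p(E/L)` and `P ↦ d` is the compact Kummer map `E(L) ⊗ ℤ_p ↪ S_p(E/L)` of Howard 2004,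
§1 ("`0 → E(L) ⊗ ℤ_p → S_p(E/L) → lim← Ш_{p^n} → 0`") and Howard 2005, Prop. 1.0.4.
[cite: Howard2004HeegnerKolyvagin, §1 (descent sequence for S_p(E/L))] -/
def IsKummerFamilyOver {P : geomPoints W} (hP : ∀ σ ∈ H, σ • P = P) (d : W.torsionH1Pi p H) : Prop :=
  ∀ (k : ℕ) (Q : geomPoints W) (hQ : ((p : ℤ) ^ k) • Q = P),
    d k = W.kummerClassOver H ((p : ℤ) ^ k) Q (fun σ hσ ↦ by rw [hQ]; exact hP σ hσ)

/-- **The `ℚ_p`-subspace of `(∏_k H¹(H, E[p^k])) ⊗ ℚ` spanned by the Kummer images of a set `S` of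
`H`-fixed points**: the `ℚ`-span of the elements `1 ⊗ (c · d)` for `c ∈ ℤ_p` (acting through the
tree's `padicPi`) and `d` a Kummer family of some `P ∈ S` — i.e. the image of `(ℤ S) ⊗ ℚ_p` under the
Kummer map `E(L) ⊗ ℚ_p → S_p(E/L) ⊗ ℚ_p` (the `ℚ_p`-span is the `ℚ`-span of the `ℤ_p`-span). For
`S = E(L)` this is `E(L) ⊗ ℚ_p ⊆ S_p(E/L) ⊗ ℚ_p`. Howard 2004, §1; Howard 2005, Prop. 1.0.4 ("the image
of the Kummer map `E(K_s) ⊗ ℤ_p → 𝒮(K_s, E)`"). [cite: Howard2005, Prop. 1.0.4] -/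
def kummerRatSpan (S : Set (geomPoints W)) (hS : ∀ P ∈ S, ∀ σ ∈ H, σ • P = P) :
    Submodule ℚ (W.ratTorsionH1Pi p H) :=
  Submodule.span ℚ {x | ∃ (P : geomPoints W) (hPS : P ∈ S) (c : ℤ_[p]) (d : W.torsionH1Pi p H),
    W.IsKummerFamilyOver p H (hS P hPS) d ∧ x = W.toRatTorsionH1Pi p H (W.padicPi p H c d)}

/-- Monotonicity of `kummerRatSpan` in the set of points. [folklore] -/
theorem kummerRatSpan_mono {S S' : Set (geomPoints W)} (hS' : ∀ P ∈ S', ∀ σ ∈ H, σ • P = P)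
    (h : S ⊆ S') :
    W.kummerRatSpan p H S (fun P hP ↦ hS' P (h hP)) ≤ W.kummerRatSpan p H S' hS' := by
  refine Submodule.span_mono ?_
  rintro x ⟨P, hPS, c, d, hd, rfl⟩
  exact ⟨P, h hPS, c, d, hd, rfl⟩

end Kummer

/-! ### Points of the layers inside `E(K̄)` -/

section Layers

variable {p} [Fact p.Prime] (κ : ZpExtension K p)

/-- Elements of `Gal(K̄/K_s) = κ⁻¹(p^s ℤ_p)` fix the layer `K_s = κ.layer s` pointwise (unfolding
`IntermediateField.fixedField`; the tree's `ZpExtension.mem_layer_iff`, file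
`ModifiedTamagawaProductAnticyclotomicSquares`, is the same statement as an `iff`).
Washington, *Introduction to Cyclotomic Fields*, §13.1. [folklore] -/
theorem smul_coe_layer_eq {s : ℕ} {σ : Field.absoluteGaloisGroup K} (hσ : σ ∈ κ.layerSubgroup s)
    (x : κ.layer s) : σ • (x : AlgebraicClosure K) = x := by
  have hx : (x : AlgebraicClosure K) ∈ IntermediateField.fixedField
      ((κ.layerSubgroup s).map (Field.absoluteGaloisGroup.toAlgEquiv K).toMonoidHom) := x.2
  rw [IntermediateField.mem_fixedField_iff] at hx
  exact hx _ ⟨σ, hσ, rfl⟩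

variable {K : Type} [Field K] [NumberField K] (W : WeierstrassCurve ℚ) {p : ℕ} [Fact p.Prime]
  (κ : ZpExtension K p)

/-- **`E(K_s) → E(K̄)`** for `E/ℚ` and the layer `K_s = κ.layer s ⊆ K̄`: base change of points along
`K_s ↪ K̄` (Mathlib `Affine.Point.map`), into the tree's `geomPoints (W.baseChange K)` on which `Γ_K`
and the cohomology live; its image is fixed by `Gal(K̄/K_s)` (`smul_layerPoints`). Howard 2005, §1
(`E(K_s)`, source of the Kummer map into `𝒮(K_s, E)`). [folklore] -/
def layerPoints (s : ℕ) : (W.baseChange (κ.layer s)).toAffine.Point →+ geomPoints (W.baseChange K) :=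
  Affine.Point.map (W' := W) (algebraMap (κ.layer s) (AlgebraicClosure K)).toRatAlgHom

/-- Points of `E(K_s)` are fixed by `Gal(K̄/K_s) = κ.layerSubgroup s` inside `E(K̄)`. [folklore] -/
theorem smul_layerPoints {s : ℕ} {σ : Field.absoluteGaloisGroup K} (hσ : σ ∈ κ.layerSubgroup s)
    (P : (W.baseChange (κ.layer s)).toAffine.Point) :
    σ • W.layerPoints κ s P = W.layerPoints κ s P := by
  rcases P with _ | ⟨x, y, h⟩
  · rfl
  · change Affine.Point.map
      ((show AlgebraicClosure K ≃ₐ[K] AlgebraicClosure K from σ) :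
        AlgebraicClosure K →ₐ[K] AlgebraicClosure K)
      (Affine.Point.map _ (Affine.Point.some x y h)) = Affine.Point.map _ (Affine.Point.some x y h)
    simp only [Affine.Point.map_some, Affine.Point.some.injEq]
    exact ⟨smul_coe_layer_eq κ hσ x, smul_coe_layer_eq κ hσ y⟩

end Layers

/-! ### Level `0`: Mordell–Weil and rational points inside `S_p(E/K) ⊗ ℚ_p` -/

section LevelZero

variable {K : Type u} [Field K] [NumberField K] (W : WeierstrassCurve K) (p : ℕ) [Fact p.Prime]
  (κ : ZpExtension K p)

/-- **`E(K) ⊗ ℚ_p ⊆ S_p(E/K) ⊗ ℚ_p` at level `0` of the tower** (`κ.layerSubgroup 0 = Γ_K`,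
`K_0 = K`): the `ℚ_p`-span of the Kummer families of the points of `E(K)` (`toGeomPoints`, fixed by
all of `Γ_K`, `smul_toGeomPoints`). Howard 2004, §1 ("`0 → E(L) ⊗ ℤ_p → S_p(E/L) → …`"); Howard
2005, Prop. 1.0.4. [cite: Howard2004HeegnerKolyvagin, §1 (descent sequence for S_p(E/L))] -/
def mordellWeilRatSubspace : Submodule ℚ (W.ratTorsionH1Pi p (κ.layerSubgroup 0)) :=
  W.kummerRatSpan p (κ.layerSubgroup 0) (Set.range (toGeomPoints W))
    (by rintro _ ⟨P, rfl⟩ σ _; exact smul_toGeomPoints W σ P)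

end LevelZero

section LevelZeroRat

variable (W : WeierstrassCurve ℚ) (K : Type) [Field K] [NumberField K] (p : ℕ) [Fact p.Prime]
  (κ : ZpExtension K p)

/-- **`E(ℚ) ⊗ ℚ_p ⊆ S_p(E/K) ⊗ ℚ_p`** for `E/ℚ` at level `0` of the tower over `K`: the `ℚ_p`-span of
the Kummer families of the points of `E(K)` coming from `E(ℚ)` (`pointToBaseChange W K`, then
`toGeomPoints`). For `K` imaginary quadratic this is the `+`-part of `E(K) ⊗ ℚ_p` under `Gal(K/ℚ)`
(`E(K) ⊗ ℚ = E(ℚ) ⊗ ℚ ⊕ E^{(K)}(ℚ) ⊗ ℚ`), which is how complex conjugation enters the requesting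
line. Howard 2004, §1; Gross 1991, §1 (`E(K) ⊗ ℚ_p = E(K)^+ ⊕ E(K)^-`).
[cite: Howard2004HeegnerKolyvagin, §1 (descent sequence for S_p(E/L))] -/
def rationalPointsRatSubspace : Submodule ℚ ((W.baseChange K).ratTorsionH1Pi p (κ.layerSubgroup 0)) :=
  (W.baseChange K).kummerRatSpan p (κ.layerSubgroup 0)
    (Set.range fun P : W.toAffine.Point ↦ toGeomPoints (W.baseChange K) (W.pointToBaseChange K P))
    (by rintro _ ⟨P, rfl⟩ σ _; exact smul_toGeomPoints (W.baseChange K) σ _)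

/-- `E(ℚ) ⊗ ℚ_p ⊆ E(K) ⊗ ℚ_p` inside `S_p(E/K) ⊗ ℚ_p`. [folklore] -/
theorem rationalPointsRatSubspace_le :
    W.rationalPointsRatSubspace K p κ ≤ (W.baseChange K).mordellWeilRatSubspace p κ :=
  (W.baseChange K).kummerRatSpan_mono p (κ.layerSubgroup 0) _ (by rintro _ ⟨P, rfl⟩; exact ⟨_, rfl⟩)

end LevelZeroRat

end WeierstrassCurve

/-! ## Part 3. `𝒮_∞ = (lim←_s S_p(E/K_s)) ⊗ ℚ_p`, base projections, universal norms -/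

namespace WeierstrassCurve.LambdaAdicSelmerData

open Literature.NumberTheory.EllipticCurves

variable {K : Type u} [Field K] [NumberField K] {W : WeierstrassCurve K} {p : ℕ} [Fact p.Prime]
  {κ : ZpExtension K p} {γ : Field.absoluteGaloisGroup K} (D : W.LambdaAdicSelmerData κ γ)

/-- **Howard's `𝒮_∞ = (lim←_s 𝒮(K_s, E)) ⊗ ℚ_p`** for a `Λ`-adic Selmer datum `D`
(`D.S = lim←_s S_p(E/K_s)`): the localisation `D.S[1/p]` of the `Λ`-module `D.S` at the powers of `p`
(Mathlib `LocalizedModule`), a module over `Λ_ℚ = ratIwasawaAlgebra p` and over `Λ`, with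
`Λ → Λ_ℚ → End` a scalar tower (all Mathlib instances; `⊗_{ℤ_p} ℚ_p` = inverting `p`).
Howard, Compositio 141 (2005), §1, p. 814: "`𝒮_∞ = (lim←_s 𝒮(K_s, E)) ⊗ ℚ_p`".
[cite: Howard2005, §1 (p. 814, definition of 𝒮_∞)] -/
abbrev SInfty : Type u :=
  LocalizedModule (IwasawaAlgebra.pPowers p) D.S

/-- The canonical `Λ`-linear map `D.S = lim←_s S_p(E/K_s) → 𝒮_∞`, `a ↦ a / 1` (kernel: the `p`-power
torsion of `D.S`, trivial under Howard's hypotheses). [cite: Howard2005, §1 (p. 814)] -/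
def toSInfty : D.S →ₗ[IwasawaAlgebra p] D.SInfty :=
  LocalizedModule.mkLinearMap (IwasawaAlgebra.pPowers p) D.S

/-- `toSInfty` is a localisation map at the powers of `p ∈ Λ` (Mathlib's instance for
`LocalizedModule.mkLinearMap`, restated for the named map). [folklore] -/
instance isLocalizedModule_toSInfty :
    IsLocalizedModule (IwasawaAlgebra.pPowers p) D.toSInfty :=
  inferInstanceAs (IsLocalizedModule (IwasawaAlgebra.pPowers p)
    (LocalizedModule.mkLinearMap (IwasawaAlgebra.pPowers p) D.S))

/-- `toSInfty` as a `ℤ`-linear map (for lifting `ℤ`-linear maps out of `D.S`). [folklore] -/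
def toSInftyInt : D.S →ₗ[ℤ] D.SInfty :=
  D.toSInfty.toAddMonoidHom.toIntLinearMap

/-- Unfolding `toSInftyInt`. [folklore] -/
@[simp]
theorem toSInftyInt_apply (a : D.S) : D.toSInftyInt a = D.toSInfty a :=
  rfl

/-- `(C p)^n` acts on `D.S` as the integer `p^n`. [folklore] -/
theorem C_p_pow_smul (n : ℕ) (a : D.S) :
    ((PowerSeries.C (p : ℤ_[p]) : IwasawaAlgebra p) ^ n) • a = ((p : ℤ) ^ n) • a := by
  rw [IwasawaAlgebra.C_p_pow_eq_natCast, Nat.cast_smul_eq_nsmul, ← natCast_zsmul, Nat.cast_pow]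

/-- `(C p)^n` acts on `𝒮_∞` as the integer `p^n`. [folklore] -/
theorem C_p_pow_smul_sInfty (n : ℕ) (x : D.SInfty) :
    ((PowerSeries.C (p : ℤ_[p]) : IwasawaAlgebra p) ^ n) • x = ((p : ℤ) ^ n) • x := by
  rw [IwasawaAlgebra.C_p_pow_eq_natCast, Nat.cast_smul_eq_nsmul, ← natCast_zsmul, Nat.cast_pow]

/-- **`𝒮_∞` is the localisation of the abelian group `lim←_s S_p(E/K_s)` at the powers of the integer
`p`** (so `ℤ`-linear maps from `D.S` to groups on which `p` is invertible extend uniquely to `𝒮_∞`,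
Mathlib `IsLocalizedModule.lift`): the three conditions transfer from the `Λ`-localisation because
`(C p)^n` acts as the integer `p^n`. [folklore] -/
instance isLocalizedModule_toSInftyInt :
    IsLocalizedModule (Submonoid.powers (p : ℤ)) D.toSInftyInt where
  map_units x := by
    obtain ⟨n, hn⟩ := (Submonoid.mem_powers_iff _ _).mp x.2
    have hu := IsLocalizedModule.map_units (S := IwasawaAlgebra.pPowers p) D.toSInfty
      ⟨(PowerSeries.C (p : ℤ_[p])) ^ n, n, rfl⟩
    rw [Module.End.isUnit_iff] at hu ⊢
    have heq : ⇑(algebraMap ℤ (Module.End ℤ D.SInfty) x) =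
        ⇑(algebraMap (IwasawaAlgebra p) (Module.End (IwasawaAlgebra p) D.SInfty)
          ((PowerSeries.C (p : ℤ_[p])) ^ n)) := by
      ext y
      rw [Module.algebraMap_end_apply, Module.algebraMap_end_apply, C_p_pow_smul_sInfty, ← hn]
    rw [heq]
    exact hu
  surj y := by
    obtain ⟨⟨m, s⟩, h⟩ := IsLocalizedModule.surj (IwasawaAlgebra.pPowers p) D.toSInfty y
    obtain ⟨n, hn⟩ := (Submonoid.mem_powers_iff _ _).mp s.2
    refine ⟨⟨m, ⟨(p : ℤ) ^ n, Submonoid.pow_mem _ (Submonoid.mem_powers _) n⟩⟩, ?_⟩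
    change ((p : ℤ) ^ n) • y = D.toSInfty m
    rw [← C_p_pow_smul_sInfty, hn]
    exact h
  exists_of_eq {x₁ x₂} h := by
    obtain ⟨c, hc⟩ := IsLocalizedModule.exists_of_eq (S := IwasawaAlgebra.pPowers p)
      (f := D.toSInfty) h
    obtain ⟨n, hn⟩ := (Submonoid.mem_powers_iff _ _).mp c.2
    refine ⟨⟨(p : ℤ) ^ n, Submonoid.pow_mem _ (Submonoid.mem_powers _) n⟩, ?_⟩
    change ((p : ℤ) ^ n) • x₁ = ((p : ℤ) ^ n) • x₂
    rw [← C_p_pow_smul, ← C_p_pow_smul, hn]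
    exact hc

/-- Every element of `𝒮_∞` becomes integral after multiplication by a power of `p`:
`p^n · x = a / 1` for some `a ∈ lim←_s S_p(E/K_s)`. [folklore] -/
theorem exists_pow_smul_eq_toSInfty (x : D.SInfty) :
    ∃ (n : ℕ) (a : D.S), ((p : ℤ) ^ n) • x = D.toSInfty a := by
  obtain ⟨⟨a, c⟩, hc⟩ := IsLocalizedModule.surj (Submonoid.powers (p : ℤ)) D.toSInftyInt x
  obtain ⟨n, hn⟩ := (Submonoid.mem_powers_iff _ _).mp c.2
  exact ⟨n, a, by rw [hn]; exact hc⟩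

/-! ### Base projections `pr_s : 𝒮_∞ → S_p(E/K_s) ⊗ ℚ_p` -/

/-- **The base projection `pr_s : 𝒮_∞ → S_p(E/K_s) ⊗ ℚ_p`** (the `s`-th control map; `pr_0` is the
base projection to `S_p(E/K) ⊗ ℚ_p` of the request): the unique `ℤ`-linear extension to
`𝒮_∞ = D.S[1/p]` of `a ↦ 1 ⊗ proj_s(a)` (`D.proj s`, valued in the `ℚ`-vector space
`(∏_k H¹(Gal(K̄/K_s), E[p^k])) ⊗ ℚ`, on which `p` is invertible; Mathlib `IsLocalizedModule.lift`). It
lands in `S_p(E/K_s) ⊗ ℚ_p` (`projInfty_mem`). Howard 2005, §1 (`𝒮_∞ → 𝒮(K_s, E) ⊗ ℚ_p`,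
`lim← a_s ↦ a_s`); Bertolini 1995, §1 (corestriction / universal norms).
[cite: Howard2005, §1 (p. 814)] -/
def projInfty (s : ℕ) : D.SInfty →ₗ[ℤ] W.ratTorsionH1Pi p (κ.layerSubgroup s) :=
  IsLocalizedModule.lift (Submonoid.powers (p : ℤ)) D.toSInftyInt
    ((TensorProduct.mk ℤ ℚ (W.torsionH1Pi p (κ.layerSubgroup s)) 1).comp (D.proj s).toIntLinearMap)
    (isUnit_algebraMap_int_end_of_rat p (W.ratTorsionH1Pi p (κ.layerSubgroup s)))

/-- `pr_s (a / 1) = 1 ⊗ proj_s a`. [cite: Howard2005, §1 (p. 814)] -/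
@[simp]
theorem projInfty_toSInfty (s : ℕ) (a : D.S) :
    D.projInfty s (D.toSInfty a) = (1 : ℚ) ⊗ₜ[ℤ] D.proj s a :=
  IsLocalizedModule.lift_apply (Submonoid.powers (p : ℤ)) D.toSInftyInt _ _ a

/-- **`pr_s` lands in `S_p(E/K_s) ⊗ ℚ_p`**: `p^n x = a/1` for some `a`, and `proj_s a ∈ S_p(E/K_s)`
(`proj_mem`). [cite: Howard2005, §1 (p. 814)] -/
theorem projInfty_mem (s : ℕ) (x : D.SInfty) :
    D.projInfty s x ∈ W.ratCompactSelmerOver p (κ.layerSubgroup s) := by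
  obtain ⟨⟨a, c⟩, hc⟩ := IsLocalizedModule.surj (Submonoid.powers (p : ℤ)) D.toSInftyInt x
  obtain ⟨n, hn⟩ := (Submonoid.mem_powers_iff _ _).mp c.2
  have key : ((c : ℤ) : ℚ) • D.projInfty s x = (1 : ℚ) ⊗ₜ[ℤ] D.proj s a := by
    rw [Int.cast_smul_eq_zsmul, ← LinearMap.map_smul, ← Submonoid.smul_def, hc]
    exact D.projInfty_toSInfty s a
  have hc0 : ((c : ℤ) : ℚ) ≠ 0 := by
    rw [← hn]
    exact_mod_cast pow_ne_zero n (Fact.out : p.Prime).ne_zero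
  rw [← inv_smul_smul₀ hc0 (D.projInfty s x), key]
  exact Submodule.smul_mem _ _
    (W.toRatTorsionH1Pi_mem_ratCompactSelmerOver p (κ.layerSubgroup s) (D.proj_mem s a))

/-! ### Universal norms -/

/-- **The universal-norm subspace at level `s`**: the `ℚ`-subspace of `S_p(E/K_s) ⊗ ℚ_p` spanned by
`pr_s(𝒮_∞)` (the image of `𝒮_∞ → 𝒮(K_s, E) ⊗ ℚ_p`; a `ℚ_p`-subspace, `𝒮_∞` being a `Λ_ℚ`-module).
At `s = 0`, when `𝒮_∞ = Λ_ℚ g` is free of rank one (`Howard2005_SInfty_free`), this is the line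
`ℚ_p · pr_0(g)` of universal norms — the "shadow line" `ℓ_K ⊂ S_p(E/K) ⊗ ℚ_p` of the requesting line
(`pr_0(f g) = f(0) pr_0(g)`, as `T = γ - 1` acts as `0` on `H¹(K, ·)`), typed without a choice of
generator. Bertolini 1995 (universal norms in the anticyclotomic tower); Howard 2005, §1.
[cite: Howard2005, §1 (p. 814)] [cite: Bertolini1995, §1] -/
def universalNormSubspace (s : ℕ) : Submodule ℚ (W.ratTorsionH1Pi p (κ.layerSubgroup s)) :=
  Submodule.span ℚ (Set.range (D.projInfty s))

/-- `pr_s x` lies in the universal-norm subspace. [folklore] -/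
theorem projInfty_mem_universalNormSubspace (s : ℕ) (x : D.SInfty) :
    D.projInfty s x ∈ D.universalNormSubspace s :=
  Submodule.subset_span ⟨x, rfl⟩

/-- **Universal norms are Selmer**: `universalNormSubspace D s ≤ S_p(E/K_s) ⊗ ℚ_p`.
[cite: Howard2005, §1 (p. 814)] -/
theorem universalNormSubspace_le (s : ℕ) :
    D.universalNormSubspace s ≤ W.ratCompactSelmerOver p (κ.layerSubgroup s) :=
  Submodule.span_le.mpr (by rintro _ ⟨x, rfl⟩; exact D.projInfty_mem s x)

/-! ### Universal norms vs. Mordell–Weil: the predicates of the requesting line -/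

/-- **`pr_0(𝒮_∞) ⊆ E(K) ⊗ ℚ_p`**: the universal norms at level `0` are Kummer images of `K`-rational
points (automatic when `Ш(E/K)[p^∞]` is finite, since then `S_p(E/K) = E(K) ⊗ ℤ_p`). A *predicate*
on the datum `D` (explicit binder), asserted nowhere in this file. Bertolini 1995 (universal norms
vs. Mordell–Weil in the anticyclotomic tower). [cite: Bertolini1995, §1] -/
def HasMordellWeilUniversalNorms (D : W.LambdaAdicSelmerData κ γ) : Prop :=
  D.universalNormSubspace 0 ≤ W.mordellWeilRatSubspace p κ

section Rat

variable {K : Type} [Field K] [NumberField K] {W : WeierstrassCurve ℚ} {p : ℕ} [Fact p.Prime]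
  {κ : ZpExtension K p} {γ : Field.absoluteGaloisGroup K}

/-- **"UNMW(K, p)": `pr_0(𝒮_∞) ⊆ E(ℚ) ⊗ ℚ_p`** — the universal norms of the tower `K_∞/K` at level
`0` are Kummer images of *rational* points ("`ℓ_K ⊂ E(ℚ) ⊗ ℚ_p`" in the requesting line; expected when
`Ш(E/K)[p^∞]` is finite and the universal-norm line lies in the `+`-eigenspace, e.g. `rank E(ℚ) = 2`,
`rank E^{(K)}(ℚ) = 1`). A *predicate* on the datum (explicit binder), asserted nowhere in this file.
[cite: Bertolini1995, §1] -/
def HasRationalUniversalNorms (D : (W.baseChange K).LambdaAdicSelmerData κ γ) : Prop :=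
  D.universalNormSubspace 0 ≤ W.rationalPointsRatSubspace K p κ

/-- `HasRationalUniversalNorms → HasMordellWeilUniversalNorms`. [folklore] -/
theorem HasRationalUniversalNorms.hasMordellWeilUniversalNorms
    {D : (W.baseChange K).LambdaAdicSelmerData κ γ} (h : D.HasRationalUniversalNorms) :
    D.HasMordellWeilUniversalNorms :=
  le_trans h (W.rationalPointsRatSubspace_le K p κ)

end Rat

/-! ### The rational Heegner module -/

section Heegner

variable {K : Type u} [Field K] [NumberField K] {N : ℕ} [NeZero N] {W : WeierstrassCurve ℚ}
  {p : ℕ} [Fact p.Prime] {κ : ZpExtension K p} {γ : Field.absoluteGaloisGroup K}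
  {jbar : AlgebraicClosure K →+* ℂ}
  (D : (W.baseChange K).LambdaAdicSelmerData κ γ) (F : HeegnerFamily N W K κ jbar)

/-- **Howard's Heegner submodule `ℋ ⊂ 𝒮_∞`**: the `Λ_ℚ`-span of the image of the integral Heegner module
`ℋ_∞ = heegnerModule D F ⊆ D.S` (Perrin-Riou's `ℋ_∞`, Howard 2004's `𝐇`) in `𝒮_∞ = D.S[1/p]`.
Howard 2005, §1, p. 814: "define the Heegner submodule `ℋ ⊂ 𝒮_∞` to be the `Λ_anti`-submodule
generated by `ỹ_∞`" (free of rank one by Cornut–Vatsal). [cite: Howard2005, §1 (p. 814, ℋ)] -/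
def ratHeegnerModule : Submodule (ratIwasawaAlgebra p) D.SInfty :=
  Submodule.span (ratIwasawaAlgebra p) (D.toSInfty '' (heegnerModule D F))

/-- **`char(𝒮_∞/ℋ) ⊆ Λ_ℚ`** (Howard 2005, §1, eq. (1.2) and p. 815: the characteristic ideal of the
`Λ_anti`-module `𝒮_∞/ℋ`), through the tree's `Module.charIdeal`. Its order at the augmentation
prime `(T)` is the integral `heegnerModuleIndex D F` when `D.S` has no `p`-torsion.
[cite: Howard2005, §1 (p. 815, char(𝒮_∞/ℋ))] -/
def ratHeegnerCharIdeal : Ideal (ratIwasawaAlgebra p) :=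
  Module.charIdeal (ratIwasawaAlgebra p) (D.SInfty ⧸ D.ratHeegnerModule F)

end Heegner

end WeierstrassCurve.LambdaAdicSelmerData

/-! ## Part 4. `Λ`-adic heights (Howard 2005, Prop. 1.0.4; Perrin-Riou 1992) -/

namespace Literature.NumberTheory.EllipticCurves

open _root_.WeierstrassCurve

section Heights

variable (W : WeierstrassCurve ℚ) {K : Type} [Field K] [NumberField K] {p : ℕ} [Fact p.Prime]
  {κ : ZpExtension K p} {γ : Field.absoluteGaloisGroup K}

/-- **`Λ`-adic height data** (hypothesis structure for Howard 2005, Prop. 1.0.4 = Perrin-Riou's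
`p`-adic heights in the tower). For a `Λ`-adic Selmer datum `D` of `E/K` (`E/ℚ` with model `W`) a
term packages, *integrally*:
* `c` and `pairingLayer s = p^c · 𝔥_s : S_p(E/K_s) × S_p(E/K_s) → ℤ_p` — Howard: "`𝔥_s : 𝒮(K_s, E) ×
  𝒮(K_s, E) → c⁻¹ℤ_p` […] where `c ∈ ℤ_p` is independent of `s`" (only `ord_p c` matters; here
  `c` is that exponent), symmetric (`pairingLayer_symm`) and `Gal(K_s/K)`-equivariant on the
  projections of `D` (`pairingLayer_conj`: `𝔥_s(γa, γb) = 𝔥_s(a, b)`, with `(γ a)_s = conj_γ a_s`,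
  i.e. `proj_s ((1+T) a)` by `proj_X`);
* the normalisation at level `0` (`pairingZero_kummer`): "whose restriction to the image of the
  Kummer map `E(K_s) ⊗ ℤ_p → 𝒮(K_s, E)` agrees with the pairing `⟨ , ⟩_{E,K_s}`" — at `s = 0`, with
  `⟨ , ⟩_{E,K}` the tree's canonical cyclotomic `p`-adic height of `E/K`, `cyclotomicPAdicHeightK W p K`
  (canonical for `p` split in the imaginary quadratic `K`; at the layers `s ≥ 1`, where `p`
  ramifies, the tree has no canonical height and `𝔥_s` is constrained only by the other fields);
* `pairing = p^c · 𝔥_∞ : D.S × D.S → Λ` pinned down by Howard's *definition*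
  `𝔥_∞(lim← a_s, lim← b_s) = lim←_s ∑_{σ ∈ Gal(K_s/K)} 𝔥_s(a_s, b_s^σ) · σ` as the congruences
  `pairing_spec`: modulo `ω_s = (1+T)^{p^s} - 1` (the kernel of `Λ → ℤ_p[Gal(K_s/K)]`, `γ ↦ 1+T`),
  `p^c 𝔥_∞(a, b) ≡ ∑_{i<p^s} p^c 𝔥_s(proj_s a, proj_s((1+T)^i b)) · (1+T)^i`, where
  `b_s^{γ^i} := conj_{γ^i} b_s = proj_s((1+T)^i b)`; since `⋂_s ω_s Λ = 0` these determine `pairing`;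
* the (redundant, recorded for convenience) sesquilinearity consequences `pairing_smul_left`
  (`Λ`-linear in the first variable) and `pairing_gamma_right` (`(1+T) · 𝔥_∞(a, (1+T) b) = 𝔥_∞(a, b)`,
  i.e. `ι`-semilinear in the second, `ι(γ) = γ⁻¹`).
The genuine pairing `𝔥_∞ : 𝒮_∞ × 𝒮_∞ → Λ_ℚ` is `heightPairing` below. Such data exist under Howard's
hypotheses (`Howard2005_exists_lambdaAdicHeightData`).
[cite: Howard2005, Prop. 1.0.4 and the definition of 𝔥_∞ (p. 815)] [cite: PerrinRiou1992] -/
structure LambdaAdicHeightData (D : (W.baseChange K).LambdaAdicSelmerData κ γ) where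
  /-- The exponent `c`: all `𝔥_s` take values in `p^{-c} ℤ_p`. -/
  c : ℕ
  /-- `p^c · 𝔥_s` on `S_p(E/K_s) = compactSelmerOver (W.baseChange K) (κ.layerSubgroup s) p`. -/
  pairingLayer (s : ℕ) : (W.baseChange K).compactSelmerOver (κ.layerSubgroup s) p →+
    (W.baseChange K).compactSelmerOver (κ.layerSubgroup s) p →+ ℤ_[p]
  /-- `𝔥_s` is symmetric. -/
  pairingLayer_symm : ∀ s a b, pairingLayer s a b = pairingLayer s b a
  /-- `𝔥_s` is `Gal(K_s/K)`-equivariant on projections: `𝔥_s(γ a_s, γ b_s) = 𝔥_s(a_s, b_s)`. -/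
  pairingLayer_conj : ∀ (s : ℕ) (a b : D.S),
    pairingLayer s ⟨D.proj s (((1 : IwasawaAlgebra p) + PowerSeries.X) • a), D.proj_mem s _⟩
        ⟨D.proj s (((1 : IwasawaAlgebra p) + PowerSeries.X) • b), D.proj_mem s _⟩ =
      pairingLayer s ⟨D.proj s a, D.proj_mem s a⟩ ⟨D.proj s b, D.proj_mem s b⟩
  /-- Level `0`: on Kummer images `p^c 𝔥_0` is `p^c` times the canonical `p`-adic height of `E/K`. -/
  pairingZero_kummer : ∀ (P Q : (W.baseChange K).toAffine.Point)
    (a b : (W.baseChange K).compactSelmerOver (κ.layerSubgroup 0) p),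
    (W.baseChange K).IsKummerFamilyOver p (κ.layerSubgroup 0)
        (fun σ _ ↦ smul_toGeomPoints (W.baseChange K) σ P) (a : (W.baseChange K).torsionH1Pi p _) →
    (W.baseChange K).IsKummerFamilyOver p (κ.layerSubgroup 0)
        (fun σ _ ↦ smul_toGeomPoints (W.baseChange K) σ Q) (b : (W.baseChange K).torsionH1Pi p _) →
    ((pairingLayer 0 a b : ℤ_[p]) : ℚ_[p]) =
      (p : ℚ_[p]) ^ c * (W.cyclotomicPAdicHeightK p K).pairing P Q
  /-- `p^c · 𝔥_∞` on the integral module `D.S = lim←_s S_p(E/K_s)`. -/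
  pairing : D.S →+ D.S →+ IwasawaAlgebra p
  /-- Howard's defining formula for `𝔥_∞`, as congruences modulo `ω_s = (1+T)^{p^s} - 1`. -/
  pairing_spec : ∀ (s : ℕ) (a b : D.S),
    pairing a b - ∑ i ∈ Finset.range (p ^ s),
      PowerSeries.C (pairingLayer s ⟨D.proj s a, D.proj_mem s a⟩
        ⟨D.proj s ((((1 : IwasawaAlgebra p) + PowerSeries.X) ^ i) • b), D.proj_mem s _⟩) *
        ((1 : IwasawaAlgebra p) + PowerSeries.X) ^ i ∈
      Ideal.span {((1 : IwasawaAlgebra p) + PowerSeries.X) ^ (p ^ s) - 1}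
  /-- `𝔥_∞` is `Λ`-linear in the first variable (consequence of the formula; recorded). -/
  pairing_smul_left : ∀ (f : IwasawaAlgebra p) (a b : D.S), pairing (f • a) b = f * pairing a b
  /-- `γ · 𝔥_∞(a, γ b) = 𝔥_∞(a, b)`: `ι`-semilinear in the second variable (consequence; recorded). -/
  pairing_gamma_right : ∀ (a b : D.S),
    ((1 : IwasawaAlgebra p) + PowerSeries.X) * pairing a (((1 : IwasawaAlgebra p) + PowerSeries.X) • b) =
      pairing a b

namespace LambdaAdicHeightData

variable {W} {D : (W.baseChange K).LambdaAdicSelmerData κ γ} (H : LambdaAdicHeightData W D)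

/-- `p^c 𝔥_∞` followed by `Λ → Λ_ℚ`, as a biadditive map `D.S → D.S → Λ_ℚ` (auxiliary). [folklore] -/
def pairingRat : D.S →+ D.S →+ ratIwasawaAlgebra p where
  toFun a := (algebraMap (IwasawaAlgebra p) (ratIwasawaAlgebra p)).toAddMonoidHom.comp (H.pairing a)
  map_zero' := by ext b; simp
  map_add' a a' := by ext b; simp

/-- Unfolding `pairingRat`. [folklore] -/
@[simp]
theorem pairingRat_apply (a b : D.S) :
    H.pairingRat a b = algebraMap (IwasawaAlgebra p) (ratIwasawaAlgebra p) (H.pairing a b) :=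
  rfl

/-- First extension step: `p^c 𝔥_∞(·, b)` extended to `𝒮_∞` in the first variable (auxiliary;
`IsLocalizedModule.lift` along the `ℤ`-localisation `D.S → 𝒮_∞`, the integer `p` acting invertibly
on the `Λ_ℚ`-module `D.S →+ Λ_ℚ`). [folklore] -/
def liftLeft : D.SInfty →ₗ[ℤ] (D.S →+ ratIwasawaAlgebra p) :=
  IsLocalizedModule.lift (Submonoid.powers (p : ℤ)) D.toSInftyInt H.pairingRat.toIntLinearMap
    (isUnit_algebraMap_int_end_of_module p (D.S →+ ratIwasawaAlgebra p))

/-- `liftLeft (a/1) = p^c 𝔥_∞(a, ·)`. [folklore] -/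
@[simp]
theorem liftLeft_toSInfty (a : D.S) : H.liftLeft (D.toSInfty a) = H.pairingRat a :=
  IsLocalizedModule.lift_apply (Submonoid.powers (p : ℤ)) D.toSInftyInt _ _ a

/-- `b ↦ (x ↦ liftLeft x b)` (auxiliary flip, biadditive). [folklore] -/
def liftLeftFlip : D.S →+ (D.SInfty →+ ratIwasawaAlgebra p) where
  toFun b :=
    { toFun := fun x ↦ H.liftLeft x b
      map_zero' := by rw [map_zero, AddMonoidHom.zero_apply]
      map_add' := fun x y ↦ by rw [map_add, AddMonoidHom.add_apply] }
  map_zero' := by ext x; exact map_zero (H.liftLeft x)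
  map_add' b b' := by ext x; exact map_add (H.liftLeft x) b b'

/-- Unfolding `liftLeftFlip`. [folklore] -/
@[simp]
theorem liftLeftFlip_apply (b : D.S) (x : D.SInfty) : H.liftLeftFlip b x = H.liftLeft x b :=
  rfl

/-- Second extension step, in the second variable (auxiliary). [folklore] -/
def liftRight : D.SInfty →ₗ[ℤ] (D.SInfty →+ ratIwasawaAlgebra p) :=
  IsLocalizedModule.lift (Submonoid.powers (p : ℤ)) D.toSInftyInt H.liftLeftFlip.toIntLinearMap
    (isUnit_algebraMap_int_end_of_module p (D.SInfty →+ ratIwasawaAlgebra p))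

/-- `liftRight (b/1) = liftLeftFlip b`. [folklore] -/
@[simp]
theorem liftRight_toSInfty (b : D.S) : H.liftRight (D.toSInfty b) = H.liftLeftFlip b :=
  IsLocalizedModule.lift_apply (Submonoid.powers (p : ℤ)) D.toSInftyInt _ _ b

/-- **Perrin-Riou's `Λ_anti`-adic height pairing `𝔥_∞ : 𝒮_∞ × 𝒮_∞ → Λ_ℚ`** of the datum: `p^{-c}`
times the unique biadditive extension of `p^c 𝔥_∞ : D.S × D.S → Λ ⊆ Λ_ℚ` to `𝒮_∞ = D.S[1/p]`
(`heightPairing_toSInfty`). Howard 2005, Prop. 1.0.4: "There is a `Λ_anti`-adic height pairing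
`𝔥_∞ : 𝒮_∞ × 𝒮_∞ → Λ_anti` defined by `𝔥_∞(lim← a_s, lim← b_s) = lim← ∑_{σ ∈ Gal(K_s/K)}
𝔥_s(a_s, b_s^σ) · σ`". [cite: Howard2005, Prop. 1.0.4 (definition of 𝔥_∞)] [cite: PerrinRiou1992] -/
def heightPairing : D.SInfty →+ D.SInfty →+ ratIwasawaAlgebra p where
  toFun x := (AddMonoidHom.mulLeft (ratIwasawaAlgebra.invPPow p H.c)).comp
    (H.liftRight.toAddMonoidHom.flip x)
  map_zero' := by ext y; simp
  map_add' x x' := by ext y; simp [mul_add]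

/-- Unfolding `heightPairing`: `𝔥_∞(x, y) = p^{-c} · liftRight y x`. [folklore] -/
theorem heightPairing_apply (x y : D.SInfty) :
    H.heightPairing x y = ratIwasawaAlgebra.invPPow p H.c * H.liftRight y x :=
  rfl

/-- **`𝔥_∞` on integral elements**: `𝔥_∞(a/1, b/1) = p^{-c} · (p^c 𝔥_∞(a, b))` in `Λ_ℚ`.
[cite: Howard2005, Prop. 1.0.4] -/
theorem heightPairing_toSInfty (a b : D.S) :
    H.heightPairing (D.toSInfty a) (D.toSInfty b) =
      ratIwasawaAlgebra.invPPow p H.c *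
        algebraMap (IwasawaAlgebra p) (ratIwasawaAlgebra p) (H.pairing a b) := by
  rw [heightPairing_apply, liftRight_toSInfty, liftLeftFlip_apply, liftLeft_toSInfty, pairingRat_apply]

/-- **Howard's `Λ_anti`-adic regulator `ℛ ⊆ Λ_ℚ`**: the ideal generated by the values of `𝔥_∞` on
`𝒮_∞ × 𝒮_∞` (Howard: "we define the `Λ_anti`-adic regulator `ℛ` to be the image of this map"; for
`𝒮_∞ = Λ_ℚ g` free of rank one the image is the principal ideal `𝔥_∞(g, g) Λ_ℚ`).
[cite: Howard2005, Prop. 1.0.4 (definition of ℛ)] -/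
def regulator : Ideal (ratIwasawaAlgebra p) :=
  Ideal.span (Set.range fun ab : D.SInfty × D.SInfty ↦ H.heightPairing ab.1 ab.2)

/-- `𝔥_∞(x, y) ∈ ℛ`. [folklore] -/
theorem heightPairing_mem_regulator (x y : D.SInfty) : H.heightPairing x y ∈ H.regulator :=
  Ideal.subset_span ⟨(x, y), rfl⟩

/-- **The constant term of `p^c 𝔥_∞` is `p^c 𝔥_0` on the base projections**: `pairing_spec` at
`s = 0` reads `p^c 𝔥_∞(a, b) ≡ p^c 𝔥_0(proj_0 a, proj_0 b) (mod T)`, and `constantCoeff` kills `(T)`.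
This is the compatibility "`𝔥_∞ ↦ 𝔥_0` under `Λ_anti → ℚ_p`" used to read the cyclotomic height of
the base projection of a `Λ`-adic class off `𝔥_∞`. [cite: Howard2005, Prop. 1.0.4] -/
theorem constantCoeff_pairing (a b : D.S) :
    PowerSeries.constantCoeff (H.pairing a b) =
      H.pairingLayer 0 ⟨D.proj 0 a, D.proj_mem 0 a⟩ ⟨D.proj 0 b, D.proj_mem 0 b⟩ := by
  have h := H.pairing_spec 0 a b
  simp only [pow_zero, pow_one, Finset.range_one, Finset.sum_singleton, mul_one, one_smul,
    add_sub_cancel_left, Ideal.mem_span_singleton] at h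
  obtain ⟨q, hq⟩ := h
  have h0 := congrArg PowerSeries.constantCoeff hq
  rw [map_sub, PowerSeries.constantCoeff_C, map_mul, PowerSeries.constantCoeff_X, zero_mul,
    sub_eq_zero] at h0
  exact h0

end LambdaAdicHeightData

end Heights

/-! ## Part 5. The theorems of Howard 2005, §1 as named facts -/

section Facts

variable (N : ℕ) [NeZero N] (W : WeierstrassCurve ℚ) [W.IsGloballyMinimal] (K : Type) [Field K]
  [NumberField K] (p : ℕ) [Fact p.Prime] (κ : ZpExtension K p) (γ : Field.absoluteGaloisGroup K)
  (jbar : AlgebraicClosure K →+* ℂ)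

/-- **`𝒮_∞` is free of rank one over `Λ_anti`** (Howard 2005, §1, p. 815: "It is known by work of
Bertolini and the author [Bertolini 1995; Howard 2004] that `X` is a finitely-generated rank-one
`Λ_anti`-module, `𝒮_∞` is free of rank one, and `char(X_tors)` divides
`char(𝒮_∞/ℋ) · char(𝒮_∞/ℋ)^ι`"), recorded for `𝒮_∞ = D.SInfty` over `Λ_ℚ = ratIwasawaAlgebra p`
under Howard's hypotheses at that point: those of his Thm. 1 ("`D` is odd and `≠ -3`, and
`ε(p) = 1`", with the standing `(p, DN) = 1`, `f` ordinary at `p`, Heegner hypothesis) and "`Gal(K̄/K)`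
surjects onto the `ℤ_p`-module automorphisms of `T_p(E)` and `p` does not divide the class number of
`K`", transcribed as the tree's `HowardHypotheses N W K p κ γ` (Howard 2004: in particular
`d_K ≠ -3, -4`, `p` odd, `p ∤ N d_K h_K`, surjectivity, good ordinary, `κ` anticyclotomic, `γ` a
topological generator) together with `d_K` odd and `p` split in `K` (`ε(p) = 1`: two primes of
`𝓞 K` above `p`); `N = N_E` is tied to `E` by the Heegner family `F`, as in `Howard2004_thmB`. Over
`Λ` itself the tree records Howard 2004, Thm. B ("torsion-free of rank one", `Howard2004_thmB`), from
which this follows because `Λ_ℚ` is a principal ideal domain (`Howard2005_SInfty_free_of_thmB`,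
Part 6). [cite: Howard2005, §1 (p. 815, "𝒮_∞ is free of rank one")] [cite: Howard2004HeegnerKolyvagin, §1 Thm. B]
[cite: Bertolini1995] -/
def Howard2005_SInfty_free : Prop :=
  ∀ (_ : HowardHypotheses N W K p κ γ) (_ : Odd (NumberField.discr K).natAbs)
    (_ : ((Ideal.span {(p : ℤ)}).primesOver (𝓞 K)).ncard = 2)
    (D : (W.baseChange K).LambdaAdicSelmerData κ γ) (_ : HeegnerFamily N W K κ jbar),
    Module.Free (ratIwasawaAlgebra p) D.SInfty ∧ Module.finrank (ratIwasawaAlgebra p) D.SInfty = 1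

/-- **Howard 2005, Prop. 1.0.4 (Perrin-Riou): `Λ`-adic height data exist.** Printed: "There is a
`p`-adic height pairing `𝔥_s : 𝒮(K_s, E) × 𝒮(K_s, E) → c⁻¹ℤ_p` whose restriction to the image of
the Kummer map `E(K_s) ⊗ ℤ_p → 𝒮(K_s, E)` agrees with the pairing `⟨ , ⟩_{E,K_s}` of (global
abelian) after identifying `E ≅ E^∨` in the canonical way, where `c ∈ ℤ_p` is independent of `s`.
There is a `Λ_anti`-adic height pairing `𝔥_∞ : 𝒮_∞ × 𝒮_∞ → Λ_anti` defined by
`𝔥_∞(lim← a_s, lim← b_s) = lim← ∑_{σ ∈ Gal(K_s/K)} 𝔥_s(a_s, b_s^σ) · σ`" (with, p. 814: "the pairing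
`⟨ , ⟩_{E,H_s}` is canonical. This follows from the ordinarity of `E` at `p` and the uniqueness
claims of Proposition 4.x"). Recorded as the non-emptiness of `LambdaAdicHeightData W D` under the
same hypotheses as `Howard2005_SInfty_free`, plus the existence of a canonical cyclotomic height
datum for `E/K` (`∃ DK, DK.IsCanonical`, so that the tree's `cyclotomicPAdicHeightK W p K` in the
level-`0` normalisation field is Howard's canonical `⟨ , ⟩_{E,K}` — up to the universal normalisation
constants of the two conventions, which the exponent `c` and `ℤ_p^×` absorb).
[cite: Howard2005, Prop. 1.0.4] [cite: PerrinRiou1992] [cite: PerrinRiou1987BSMF, §0] -/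
def Howard2005_exists_lambdaAdicHeightData : Prop :=
  ∀ (_ : HowardHypotheses N W K p κ γ) (_ : Odd (NumberField.discr K).natAbs)
    (_ : ((Ideal.span {(p : ℤ)}).primesOver (𝓞 K)).ncard = 2)
    (_ : ∃ DK : PAdicHeightDataK W p K, DK.IsCanonical)
    (D : (W.baseChange K).LambdaAdicSelmerData κ γ) (_ : HeegnerFamily N W K κ jbar),
    Nonempty (LambdaAdicHeightData W D)

end Facts

/-! ## Part 6. `Λ_ℚ` is a principal ideal domain; `𝒮_∞` is free of rank one from Howard 2004, Thm. B -/

section PID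

variable (p : ℕ) [Fact p.Prime]

/-- `Λ_ℚ = Λ[1/p]` is a domain (localisation of the domain `Λ` at non-zero elements). [folklore] -/
instance ratIwasawaAlgebra.instIsDomain : IsDomain (ratIwasawaAlgebra p) :=
  IsLocalization.isDomain_localization (IwasawaAlgebra.pPowers_le_nonZeroDivisors p)

/-- **A prime of `Λ = ℤ_p⟦T⟧` not containing `p` is principal**: it has height `≤ 1`
(`IwasawaAlgebra.height_le_one_of_C_p_notMem`: it lies strictly below `𝔪 = (p, T)` of height `2`),
so it is `⊥` or a height-one prime, which is `(p)` or `(f)` with `f` distinguished irreducible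
(`IwasawaAlgebra.eq_span_of_height_eq_one`; Washington, *Introduction to Cyclotomic Fields*, §13.2:
`Λ` is a UFD whose primes of height one are principal). [folklore] -/
theorem IwasawaAlgebra.isPrincipal_of_C_p_notMem (𝔮 : Ideal (IwasawaAlgebra p)) [𝔮.IsPrime]
    (hp : (PowerSeries.C (p : ℤ_[p]) : IwasawaAlgebra p) ∉ 𝔮) : 𝔮.IsPrincipal := by
  have hle := IwasawaAlgebra.height_le_one_of_C_p_notMem p 𝔮 hp
  rcases eq_or_lt_of_le hle with h1 | h0
  · rcases IwasawaAlgebra.eq_span_of_height_eq_one p 𝔮 h1 with h | ⟨f, -, -, h⟩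
    · exact ⟨⟨_, by rw [h]⟩⟩
    · exact ⟨⟨_, by rw [h]⟩⟩
  · rw [Order.lt_one_iff, Ideal.height_eq_zero_iff_eq_bot] at h0
    rw [h0]
    exact bot_isPrincipal

/-- **`Λ_ℚ = ℤ_p⟦T⟧[1/p]` is a principal ideal domain.** Every prime `𝔓` of the localisation is
extended from the prime `𝔮 = 𝔓 ∩ Λ` (Mathlib `IsLocalization.map_under`), which does not contain the
unit `p` and is therefore principal (`isPrincipal_of_C_p_notMem`); a ring all of whose primes are
principal is a principal ideal ring (Kaplansky; Mathlib `IsPrincipalIdealRing.of_prime`). This is the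
algebra behind "torsion-free of rank one over `Λ`" ⇒ "free of rank one over `Λ ⊗ ℚ_p`"
(Howard 2004, Thm. B ⇒ Howard 2005, §1). [folklore] -/
instance ratIwasawaAlgebra.instIsPrincipalIdealRing : IsPrincipalIdealRing (ratIwasawaAlgebra p) := by
  refine IsPrincipalIdealRing.of_prime fun P hP ↦ ?_
  set 𝔮 : Ideal (IwasawaAlgebra p) := P.comap (algebraMap (IwasawaAlgebra p) (ratIwasawaAlgebra p))
  have h𝔮 : 𝔮.IsPrime := Ideal.comap_isPrime _ _
  have hp𝔮 : (PowerSeries.C (p : ℤ_[p]) : IwasawaAlgebra p) ∉ 𝔮 := by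
    intro hmem
    apply hP.ne_top
    rw [Ideal.eq_top_iff_one]
    obtain ⟨u, hu⟩ := IsLocalization.map_units (ratIwasawaAlgebra p)
      (⟨PowerSeries.C (p : ℤ_[p]), Submonoid.mem_powers _⟩ : IwasawaAlgebra.pPowers p)
    have hmem' : algebraMap (IwasawaAlgebra p) (ratIwasawaAlgebra p) (PowerSeries.C (p : ℤ_[p])) ∈ P :=
      hmem
    rw [← hu] at hmem'
    simpa using P.mul_mem_left (↑u⁻¹ : ratIwasawaAlgebra p) hmem'
  obtain ⟨x, hx⟩ := (IwasawaAlgebra.isPrincipal_of_C_p_notMem p 𝔮 hp𝔮).principal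
  have hmap := IsLocalization.map_under (IwasawaAlgebra.pPowers p) (ratIwasawaAlgebra p) P
  refine ⟨⟨algebraMap (IwasawaAlgebra p) (ratIwasawaAlgebra p) x, ?_⟩⟩
  rw [← hmap]
  change Ideal.map _ 𝔮 = _
  rw [hx, Ideal.submodule_span_eq, Ideal.map_span, Set.image_singleton, Ideal.submodule_span_eq]

/-- **Localising a finitely generated torsion-free `Λ`-module of rank one at `p` gives a free
`Λ_ℚ`-module of rank one**: the localisation is finitely generated and torsion-free over the PID
`Λ_ℚ` (Mathlib instances), hence free (`Module.free_of_finite_type_torsion_free'`), and localisation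
at non-zero-divisors preserves the rank (`IsLocalizedModule.finrank_eq`, `IsLocalization.rank_eq`).
[folklore] -/
theorem free_localizedModule_pPowers_of_finrank_eq_one (M : Type*) [AddCommGroup M]
    [Module (IwasawaAlgebra p) M] [Module.Finite (IwasawaAlgebra p) M]
    [NoZeroSMulDivisors (IwasawaAlgebra p) M] (h1 : Module.finrank (IwasawaAlgebra p) M = 1) :
    Module.Free (ratIwasawaAlgebra p) (LocalizedModule (IwasawaAlgebra.pPowers p) M) ∧
      Module.finrank (ratIwasawaAlgebra p) (LocalizedModule (IwasawaAlgebra.pPowers p) M) = 1 := by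
  refine ⟨Module.free_of_finite_type_torsion_free', ?_⟩
  have hR : Module.finrank (IwasawaAlgebra p) (LocalizedModule (IwasawaAlgebra.pPowers p) M) = 1 := by
    rw [IsLocalizedModule.finrank_eq (IwasawaAlgebra.pPowers p)
      (LocalizedModule.mkLinearMap (IwasawaAlgebra.pPowers p) M)
      (IwasawaAlgebra.pPowers_le_nonZeroDivisors p), h1]
  rw [Module.finrank, IsLocalization.rank_eq (ratIwasawaAlgebra p) (IwasawaAlgebra.pPowers p)
    (IwasawaAlgebra.pPowers_le_nonZeroDivisors p), ← Module.finrank, hR]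

end PID

section FreeOfThmB

variable {N : ℕ} [NeZero N] {W : WeierstrassCurve ℚ} [W.IsGloballyMinimal] {K : Type} [Field K]
  [NumberField K] {p : ℕ} [Fact p.Prime] {κ : ZpExtension K p} {γ : Field.absoluteGaloisGroup K}
  {jbar : AlgebraicClosure K →+* ℂ}

/-- **`𝒮_∞` is free of rank one over `Λ_ℚ`, from Howard 2004, Thm. B.** Under `HowardHypotheses`,
Thm. B (`Howard2004_thmB`: `D.S = lim←_s S_p(E/K_s)` is finitely generated, torsion-free, of rank
one over `Λ`) gives, after localising at `p` over the PID `Λ_ℚ`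
(`free_localizedModule_pPowers_of_finrank_eq_one`), that `𝒮_∞ = D.SInfty` is free of rank one —
Howard 2005, §1, p. 815: "`𝒮_∞` is free of rank one". The existence of an Iwasawa-module datum `X`
(`nonempty_selmerDualData`, needed only to instantiate the statement of `Howard2004_thmB`) is the
second hypothesis. [cite: Howard2005, §1 (p. 815, "𝒮_∞ is free of rank one")]
[cite: Howard2004HeegnerKolyvagin, §1 Thm. B] -/
theorem _root_.WeierstrassCurve.LambdaAdicSelmerData.sInfty_free_of_thmB
    (hB : Howard2004_thmB N W K p κ γ jbar)
    (hX : (W.baseChange K).nonempty_selmerDualData κ γ) (hyp : HowardHypotheses N W K p κ γ)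
    (D : (W.baseChange K).LambdaAdicSelmerData κ γ) (F : HeegnerFamily N W K κ jbar) :
    Module.Free (ratIwasawaAlgebra p) D.SInfty ∧ Module.finrank (ratIwasawaAlgebra p) D.SInfty = 1 := by
  obtain ⟨X⟩ := hX hyp.topGenerator
  obtain ⟨⟨hfin, htf, h1⟩, -⟩ := hB hyp D F X
  exact free_localizedModule_pPowers_of_finrank_eq_one p D.S h1

variable (N W K p κ γ jbar) in
/-- **`Howard2005_SInfty_free` follows from `Howard2004_thmB`** (and the existence fact
`nonempty_selmerDualData`): the named fact of Part 5 is a corollary of the tree's record of Howard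
2004, Thm. B, by `WeierstrassCurve.LambdaAdicSelmerData.sInfty_free_of_thmB` (its extra hypotheses "`d_K` odd, `p`
split" are not needed). [cite: Howard2005, §1 (p. 815)] [cite: Howard2004HeegnerKolyvagin, §1 Thm. B] -/
theorem Howard2005_SInfty_free_of_thmB (hB : Howard2004_thmB N W K p κ γ jbar)
    (hX : (W.baseChange K).nonempty_selmerDualData κ γ) :
    Howard2005_SInfty_free N W K p κ γ jbar :=
  fun hyp _ _ D F ↦ D.sInfty_free_of_thmB hB hX hyp F

end FreeOfThmB

end Literature.NumberTheory.EllipticCurves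

/-! ## Part 7. Complex conjugation on the finite levels (Howard 2004, §2.3) -/

namespace Literature.NumberTheory.EllipticCurves

section OuterConj

open Field Literature.NumberTheory.GaloisRepresentations

variable (K : Type) [Field K] [NumberField K]

/-- **The transport `ĝ` of `g ∈ Γ_ℚ` to `K̄`** (abbreviation for the tree's `absGaloisTransport` with
base field `ℚ`: `ĝ = e g e⁻¹` for the pinned identification `e : ℚ̄ ≃ K̄`, a `ℚ`-algebra
automorphism of `K̄`; for `g` a restriction from `Γ_K` it is that element,
`absGaloisTransport_absGaloisRestrict`). Milne, *Fields and Galois Theory*, §7. [folklore] -/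
abbrev absGaloisTransportRat (g : absoluteGaloisGroup ℚ) :
    AlgebraicClosure K ≃ₐ[ℚ] AlgebraicClosure K :=
  absGaloisTransport (K := ℚ) (L := K) g

variable {K}

/-- `ĝ² = 1` for `g² = 1` (e.g. a complex conjugation). [folklore] -/
theorem absGaloisTransportRat_mul_self {g : absoluteGaloisGroup ℚ} (hg : g * g = 1) :
    absGaloisTransportRat K g * absGaloisTransportRat K g = 1 := by
  change absGaloisTransport (K := ℚ) (L := K) g * absGaloisTransport (K := ℚ) (L := K) g = 1
  rw [← map_mul, hg, map_one]

/-- `ĝ (ĝ x) = x` for `g² = 1`. [folklore] -/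
theorem absGaloisTransportRat_absGaloisTransportRat_apply {g : absoluteGaloisGroup ℚ}
    (hg : g * g = 1) (x : AlgebraicClosure K) :
    absGaloisTransportRat K g (absGaloisTransportRat K g x) = x := by
  rw [← AlgEquiv.mul_apply, absGaloisTransportRat_mul_self hg, AlgEquiv.one_apply]

/-- `ĝ⁻¹ = ĝ` for `g² = 1`. [folklore] -/
theorem absGaloisTransportRat_inv_of_mul_self {g : absoluteGaloisGroup ℚ} (hg : g * g = 1) :
    (absGaloisTransportRat K g)⁻¹ = absGaloisTransportRat K g :=
  inv_eq_iff_mul_eq_one.mpr (absGaloisTransportRat_mul_self hg)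

variable [Normal ℚ K]

/-- **`ĝ` preserves `K ⊆ K̄`** when `K/ℚ` is normal: `ĝ(k) = (ĝ|_K)(k)` with `ĝ|_K ∈ Aut(K/ℚ)`
(Mathlib `AlgEquiv.restrictNormal`). [folklore] -/
theorem absGaloisTransportRat_algebraMap (g : absoluteGaloisGroup ℚ) (k : K) :
    absGaloisTransportRat K g (algebraMap K (AlgebraicClosure K) k) =
      algebraMap K (AlgebraicClosure K) ((absGaloisTransportRat K g).restrictNormal K k) :=
  (AlgEquiv.restrictNormal_commutes (absGaloisTransportRat K g) K k).symm

/-- The outer automorphism `σ ↦ ĝ⁻¹ σ ĝ` of `Γ_K = Aut(K̄/K)` induced by `g ∈ Γ_ℚ`, as a function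
(the `ℚ`-automorphism `ĝ⁻¹ σ ĝ` of `K̄` is `K`-linear because `ĝ` preserves `K`, `K/ℚ` being normal).
For `K` imaginary quadratic and `g` a complex conjugation this is "conjugation by `τ`" on `G_K`,
Howard 2004, §2.3. Auxiliary for `absGaloisOuterConj`. [cite: Howard2004HeegnerKolyvagin, §2.3] -/
def absGaloisOuterConjFun (g : absoluteGaloisGroup ℚ) (σ : absoluteGaloisGroup K) :
    absoluteGaloisGroup K :=
  (absoluteGaloisGroup.toAlgEquiv K).symm
    { ((absGaloisTransportRat K g)⁻¹ *
          (absoluteGaloisGroup.toAlgEquiv K σ).restrictScalars ℚ * absGaloisTransportRat K g :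
        AlgebraicClosure K ≃ₐ[ℚ] AlgebraicClosure K) with
      commutes' := fun k ↦ by
        change (absGaloisTransportRat K g)⁻¹ ((absoluteGaloisGroup.toAlgEquiv K σ)
          (absGaloisTransportRat K g (algebraMap K _ k))) = _
        rw [absGaloisTransportRat_algebraMap, AlgEquiv.commutes, ← absGaloisTransportRat_algebraMap,
          ← AlgEquiv.mul_apply, inv_mul_cancel, AlgEquiv.one_apply] }

/-- Unfolding `absGaloisOuterConjFun` on `K̄`: `(ĝ⁻¹ σ ĝ) • x = ĝ⁻¹ (σ • ĝ x)`. [folklore] -/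
theorem absGaloisOuterConjFun_smul (g : absoluteGaloisGroup ℚ) (σ : absoluteGaloisGroup K)
    (x : AlgebraicClosure K) :
    absGaloisOuterConjFun g σ • x = (absGaloisTransportRat K g)⁻¹ (σ • absGaloisTransportRat K g x) :=
  rfl

/-- `ĝ ((ĝ⁻¹ σ ĝ) • x) = σ • ĝ x`. [folklore] -/
theorem absGaloisTransportRat_absGaloisOuterConjFun_smul (g : absoluteGaloisGroup ℚ)
    (σ : absoluteGaloisGroup K) (x : AlgebraicClosure K) :
    absGaloisTransportRat K g (absGaloisOuterConjFun g σ • x) = σ • absGaloisTransportRat K g x := by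
  rw [absGaloisOuterConjFun_smul, ← AlgEquiv.mul_apply, mul_inv_cancel, AlgEquiv.one_apply]

/-- `σ ↦ ĝ⁻¹ σ ĝ` as a group homomorphism `Γ_K → Γ_K` (auxiliary for `absGaloisOuterConj`).
[cite: Howard2004HeegnerKolyvagin, §2.3] -/
def absGaloisOuterConjHom (g : absoluteGaloisGroup ℚ) : absoluteGaloisGroup K →* absoluteGaloisGroup K where
  toFun := absGaloisOuterConjFun g
  map_one' := by
    refine FaithfulSMul.eq_of_smul_eq_smul (α := AlgebraicClosure K) fun x ↦ ?_
    rw [absGaloisOuterConjFun_smul, one_smul, one_smul, ← AlgEquiv.mul_apply, inv_mul_cancel,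
      AlgEquiv.one_apply]
  map_mul' σ τ := by
    refine FaithfulSMul.eq_of_smul_eq_smul (α := AlgebraicClosure K) fun x ↦ ?_
    rw [absGaloisOuterConjFun_smul, mul_smul, mul_smul, absGaloisOuterConjFun_smul,
      absGaloisTransportRat_absGaloisOuterConjFun_smul]

/-- Unfolding `absGaloisOuterConjHom` on `K̄`. [folklore] -/
theorem absGaloisOuterConjHom_smul (g : absoluteGaloisGroup ℚ) (σ : absoluteGaloisGroup K)
    (x : AlgebraicClosure K) :
    absGaloisOuterConjHom g σ • x = (absGaloisTransportRat K g)⁻¹ (σ • absGaloisTransportRat K g x) :=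
  rfl

/-- **`σ ↦ ĝ⁻¹ σ ĝ` is continuous for the Krull topology**: the preimage of `Gal(K̄/E)`, `E/K`
finite, contains `Gal(K̄/E')` with `E'` generated over `K` by the images under `ĝ` of a `K`-basis of
`E` (`ĝ` maps `K` to `K`, so it maps the `K`-span of the basis into the `K`-span of its image).
Same architecture as the tree's `continuous_absGaloisRestrictMonoidHom`. Neukirch, *Algebraic
Number Theory*, Ch. IV §1. [folklore] -/
theorem continuous_absGaloisOuterConjHom (g : absoluteGaloisGroup ℚ) :
    Continuous (absGaloisOuterConjHom (K := K) g) := by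
  apply continuous_of_continuousAt_one _ (continuousAt_def.mpr _)
  intro N hN
  rw [map_one] at hN
  obtain ⟨E, _, hE⟩ := (krullTopology_mem_nhds_one_iff K (AlgebraicClosure K) N).mp hN
  let b := Module.finBasis K E
  let S : Set (AlgebraicClosure K) := Set.range fun i ↦ absGaloisTransportRat K g (b i)
  let E' : IntermediateField K (AlgebraicClosure K) := IntermediateField.adjoin K S
  haveI : FiniteDimensional K E' :=
    IntermediateField.finiteDimensional_adjoin fun x _ ↦ Algebra.IsIntegral.isIntegral x
  refine (krullTopology_mem_nhds_one_iff K (AlgebraicClosure K) _).mpr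
    ⟨E', inferInstance, fun σ hσ ↦ hE ?_⟩
  rw [SetLike.mem_coe, IntermediateField.mem_fixingSubgroup_iff] at hσ
  rw [SetLike.mem_coe, IntermediateField.mem_fixingSubgroup_iff]
  -- `ĝ⁻¹ σ ĝ` fixes the basis `b` of `E`, hence all of `E`.
  have hb : ∀ i, absGaloisOuterConjHom g σ • (b i : AlgebraicClosure K) = b i := by
    intro i
    rw [absGaloisOuterConjHom_smul, AlgEquiv.aut_inv, AlgEquiv.symm_apply_eq]
    exact hσ _ (IntermediateField.subset_adjoin K S ⟨i, rfl⟩)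
  have key : ((show AlgebraicClosure K ≃ₐ[K] AlgebraicClosure K from
      absGaloisOuterConjHom g σ).toLinearMap ∘ₗ E.val.toLinearMap) = E.val.toLinearMap :=
    b.ext fun i ↦ hb i
  intro x hx
  exact congr($key ⟨x, hx⟩)

variable (K) in
/-- **The outer automorphism `σ ↦ ĝ⁻¹ σ ĝ` of `Γ_K` induced by `g ∈ Γ_ℚ`** (`K/ℚ` normal), as a
continuous group homomorphism `Γ_K →ₜ* Γ_K`. Under the restriction `Γ_K ↪ Γ_ℚ` it is conjugation by
`g` (`absGaloisRestrict_absGaloisOuterConj`); for `g = τ` a complex conjugation and `K` imaginary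
quadratic it is "the automorphism of `G_K` given by conjugation by `τ`" of Howard 2004, §2.3, through
which `τ` acts on `H¹(K, T)` by change of group. An involution for `g² = 1`
(`absGaloisOuterConj_absGaloisOuterConj_of_mul_self`). [cite: Howard2004HeegnerKolyvagin, §2.3] -/
def absGaloisOuterConj (g : absoluteGaloisGroup ℚ) : absoluteGaloisGroup K →ₜ* absoluteGaloisGroup K where
  toMonoidHom := absGaloisOuterConjHom g
  continuous_toFun := continuous_absGaloisOuterConjHom g

/-- Unfolding `absGaloisOuterConj` on `K̄`: `(ĝ⁻¹ σ ĝ) • x = ĝ⁻¹ (σ • ĝ x)`. [folklore] -/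
theorem absGaloisOuterConj_smul (g : absoluteGaloisGroup ℚ) (σ : absoluteGaloisGroup K)
    (x : AlgebraicClosure K) :
    absGaloisOuterConj K g σ • x = (absGaloisTransportRat K g)⁻¹ (σ • absGaloisTransportRat K g x) :=
  rfl

/-- `ĝ ((ĝ⁻¹ σ ĝ) • x) = σ • ĝ x`. [folklore] -/
theorem absGaloisTransportRat_absGaloisOuterConj_smul (g : absoluteGaloisGroup ℚ)
    (σ : absoluteGaloisGroup K) (x : AlgebraicClosure K) :
    absGaloisTransportRat K g (absGaloisOuterConj K g σ • x) = σ • absGaloisTransportRat K g x :=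
  absGaloisTransportRat_absGaloisOuterConjFun_smul g σ x

/-- **Compatibility with `Γ_K ↪ Γ_ℚ`**: `res (ĝ⁻¹ σ ĝ) = g⁻¹ (res σ) g` (both sides transport to the same
automorphism `ĝ⁻¹ σ ĝ` of `K̄`, `absGaloisTransport_absGaloisRestrict`). [folklore] -/
theorem absGaloisRestrict_absGaloisOuterConj (g : absoluteGaloisGroup ℚ) (σ : absoluteGaloisGroup K) :
    absGaloisRestrict ℚ K (absGaloisOuterConj K g σ) = g⁻¹ * absGaloisRestrict ℚ K σ * g := by
  apply (absGaloisTransport (K := ℚ) (L := K)).injective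
  rw [map_mul, map_mul, map_inv]
  ext y
  rw [absGaloisTransport_absGaloisRestrict, AlgEquiv.mul_apply, AlgEquiv.mul_apply,
    absGaloisTransport_absGaloisRestrict]
  rfl

/-- **Involution**: for `g² = 1`, `ĝ⁻¹ (ĝ⁻¹ σ ĝ) ĝ = σ`. [folklore] -/
theorem absGaloisOuterConj_absGaloisOuterConj_of_mul_self {g : absoluteGaloisGroup ℚ} (hg : g * g = 1)
    (σ : absoluteGaloisGroup K) : absGaloisOuterConj K g (absGaloisOuterConj K g σ) = σ := by
  refine FaithfulSMul.eq_of_smul_eq_smul (α := AlgebraicClosure K) fun x ↦ ?_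
  rw [absGaloisOuterConj_smul, absGaloisOuterConj_smul, absGaloisTransportRat_inv_of_mul_self hg,
    absGaloisTransportRat_absGaloisTransportRat_apply hg,
    absGaloisTransportRat_absGaloisTransportRat_apply hg]

/-- **Restriction to a stable subgroup `H ≤ Γ_K`** (e.g. `Gal(K̄/K_s)` of an anticyclotomic layer),
as a continuous group homomorphism `H →ₜ* H`. [folklore] -/
def absGaloisOuterConjSubgroup (g : absoluteGaloisGroup ℚ) (H : Subgroup (absoluteGaloisGroup K))
    (hH : ∀ σ ∈ H, absGaloisOuterConj K g σ ∈ H) : H →ₜ* H where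
  toFun x := ⟨absGaloisOuterConj K g (x : absoluteGaloisGroup K), hH x x.2⟩
  map_one' := Subtype.ext (map_one (absGaloisOuterConj K g))
  map_mul' x y := Subtype.ext
    (map_mul (absGaloisOuterConj K g) (x : absoluteGaloisGroup K) (y : absoluteGaloisGroup K))
  continuous_toFun := ((absGaloisOuterConj K g).continuous.comp continuous_subtype_val).subtype_mk _

/-- Unfolding `absGaloisOuterConjSubgroup` on underlying elements. [folklore] -/
@[simp]
theorem absGaloisOuterConjSubgroup_apply_coe (g : absoluteGaloisGroup ℚ)
    (H : Subgroup (absoluteGaloisGroup K)) (hH : ∀ σ ∈ H, absGaloisOuterConj K g σ ∈ H) (x : H) :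
    ((absGaloisOuterConjSubgroup g H hH x : H) : absoluteGaloisGroup K) = absGaloisOuterConj K g x :=
  rfl

/-- On a stable subgroup the restriction is an involution for `g² = 1`. [folklore] -/
theorem absGaloisOuterConjSubgroup_comp_self {g : absoluteGaloisGroup ℚ} (hg : g * g = 1)
    (H : Subgroup (absoluteGaloisGroup K)) (hH : ∀ σ ∈ H, absGaloisOuterConj K g σ ∈ H) :
    (absGaloisOuterConjSubgroup g H hH).comp (absGaloisOuterConjSubgroup g H hH) =
      ContinuousMonoidHom.id H := by
  refine ContinuousMonoidHom.ext fun x ↦ Subtype.ext ?_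
  have h1 : (((absGaloisOuterConjSubgroup g H hH).comp (absGaloisOuterConjSubgroup g H hH) x : H) :
      absoluteGaloisGroup K) =
        absGaloisOuterConj K g (absGaloisOuterConj K g (x : absoluteGaloisGroup K)) := rfl
  have h2 : ((ContinuousMonoidHom.id H x : H) : absoluteGaloisGroup K) = x := rfl
  rw [h1, h2]
  exact absGaloisOuterConj_absGaloisOuterConj_of_mul_self hg (x : absoluteGaloisGroup K)

end OuterConj

/-! ### Anticyclotomic towers: the outer conjugation stabilises every layer -/

namespace ZpExtension

open Field Literature.NumberTheory.GaloisRepresentations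

variable {K : Type} [Field K] [NumberField K] [Normal ℚ K] {p : ℕ} [Fact p.Prime]
  {κ : ZpExtension K p}

/-- **Anticyclotomy**: for `κ` anticyclotomic and `c₀ ∈ Γ_ℚ` outside the image of `Γ_K`,
`κ(ĉ₀⁻¹ σ ĉ₀) = κ(σ)⁻¹` (`IsAnticyclotomic` through `absGaloisRestrict_absGaloisOuterConj` and the
tree's `apply_eq_inv_of_absGaloisRestrict_eq_conj`). Greenberg (1987), §2: "`c` acts on
`Gal(K_∞⁻/K)` by `-1`". [cite: Greenberg1987, §2] -/
theorem apply_absGaloisOuterConj_eq_inv (hκ : κ.IsAnticyclotomic) {c₀ : absoluteGaloisGroup ℚ}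
    (hc₀ : c₀ ∉ Set.range (absGaloisRestrict ℚ K)) (σ : absoluteGaloisGroup K) :
    κ (absGaloisOuterConj K c₀ σ) = (κ σ)⁻¹ :=
  apply_eq_inv_of_absGaloisRestrict_eq_conj hκ hc₀ (absGaloisRestrict_absGaloisOuterConj c₀ σ)

/-- **The outer conjugation stabilises `Gal(K̄/K_s)`** for every layer of an anticyclotomic tower
(`p^s ∣ -x ↔ p^s ∣ x`): "`K_s/ℚ` is Galois, generalised dihedral" (Greenberg 1987, §2).
[cite: Greenberg1987, §2] -/
theorem absGaloisOuterConj_mem_layerSubgroup_iff (hκ : κ.IsAnticyclotomic)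
    {c₀ : absoluteGaloisGroup ℚ} (hc₀ : c₀ ∉ Set.range (absGaloisRestrict ℚ K))
    (σ : absoluteGaloisGroup K) (s : ℕ) :
    absGaloisOuterConj K c₀ σ ∈ κ.layerSubgroup s ↔ σ ∈ κ.layerSubgroup s :=
  mem_layerSubgroup_iff_of_apply_eq_inv (apply_absGaloisOuterConj_eq_inv hκ hc₀ σ) s

end ZpExtension

end Literature.NumberTheory.EllipticCurves

/-! ### The action on `E(K̄)`, on `E[m]` and on `H¹(H, E[m])` for `E/ℚ` -/

namespace WeierstrassCurve

open Field Literature.NumberTheory.EllipticCurves Literature.NumberTheory.GaloisRepresentations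

section OuterConjPoints

variable (W : WeierstrassCurve ℚ) (K : Type) [Field K] [NumberField K]

/-- **The action of `ĝ` on `E(K̄)`** for `E/ℚ` (model `W`) and `g ∈ Γ_ℚ`: base change of points along
the `ℚ`-automorphism `ĝ = absGaloisTransportRat K g` of `K̄` (Mathlib `Affine.Point.map`; the
equation of `E` has rational coefficients, fixed by `ĝ`), an additive automorphism of the tree's
`geomPoints (W.baseChange K)`. For `g = τ` a complex conjugation this is "action by `τ`" on
`T = T_p E` / `E[p^k]`, Howard 2004, §2.3 (`Tw(T) = T` for `E` defined over `ℚ`); Gross 1991, §1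
(complex conjugation on `E(K) ⊗ ℚ_p`). [cite: Howard2004HeegnerKolyvagin, §2.3] -/
def geomPointsOuterConj (g : absoluteGaloisGroup ℚ) :
    geomPoints (W.baseChange K) →+ geomPoints (W.baseChange K) :=
  Affine.Point.map (W' := W)
    ((absGaloisTransportRat K g : AlgebraicClosure K ≃ₐ[ℚ] AlgebraicClosure K) :
      AlgebraicClosure K →ₐ[ℚ] AlgebraicClosure K)

variable {K}

/-- The Galois action of `Γ_K` on `E(K̄)`, written as the `ℚ`-rational base change of points along the
underlying `ℚ`-algebra map of `σ` (definitional: both are "apply `σ` to the coordinates").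
[folklore] -/
theorem smul_geomPoints_eq_map_restrictScalars (τ : absoluteGaloisGroup K)
    (P : geomPoints (W.baseChange K)) :
    τ • P = Affine.Point.map (W' := W)
      (((absoluteGaloisGroup.toAlgEquiv K τ : AlgebraicClosure K ≃ₐ[K] AlgebraicClosure K) :
        AlgebraicClosure K →ₐ[K] AlgebraicClosure K).restrictScalars ℚ) P := by
  cases P <;> rfl

/-- Unfolding `geomPointsOuterConj`. [folklore] -/
theorem geomPointsOuterConj_apply (g : absoluteGaloisGroup ℚ) (P : geomPoints (W.baseChange K)) :
    W.geomPointsOuterConj K g P = Affine.Point.map (W' := W)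
      ((absGaloisTransportRat K g : AlgebraicClosure K ≃ₐ[ℚ] AlgebraicClosure K) :
        AlgebraicClosure K →ₐ[ℚ] AlgebraicClosure K) P :=
  rfl

/-- **`ĝ` is an involution on `E(K̄)`** for `g² = 1`. [folklore] -/
theorem geomPointsOuterConj_geomPointsOuterConj_of_mul_self {g : absoluteGaloisGroup ℚ}
    (hg : g * g = 1) (P : geomPoints (W.baseChange K)) :
    W.geomPointsOuterConj K g (W.geomPointsOuterConj K g P) = P := by
  rw [geomPointsOuterConj_apply, geomPointsOuterConj_apply, Affine.Point.map_map]
  have hid : ((absGaloisTransportRat K g : AlgebraicClosure K ≃ₐ[ℚ] AlgebraicClosure K) :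
      AlgebraicClosure K →ₐ[ℚ] AlgebraicClosure K).comp
        ((absGaloisTransportRat K g : AlgebraicClosure K ≃ₐ[ℚ] AlgebraicClosure K) :
          AlgebraicClosure K →ₐ[ℚ] AlgebraicClosure K) = AlgHom.id ℚ _ := by
    ext x
    exact absGaloisTransportRat_absGaloisTransportRat_apply hg x
  rw [hid]
  cases P <;> rfl

variable [Normal ℚ K]

/-- **Change of group compatibility**: `ĝ ((ĝ⁻¹ σ ĝ) • P) = σ • ĝ P`, i.e. the pair
`(σ ↦ ĝ⁻¹ σ ĝ, P ↦ ĝ P)` is a compatible pair `(Γ_K, E(K̄)) → (Γ_K, E(K̄))` in the sense of Serre,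
*Galois Cohomology*, I.§2.4 — Howard 2004, §2.3: "The identity map on the underlying `R`-modules
`T → Tw(T)` and the automorphism of `G_K` given by conjugation by `τ` induce a change of group".
[cite: Howard2004HeegnerKolyvagin, §2.3] -/
theorem geomPointsOuterConj_absGaloisOuterConj_smul (g : absoluteGaloisGroup ℚ)
    (σ : absoluteGaloisGroup K) (P : geomPoints (W.baseChange K)) :
    W.geomPointsOuterConj K g (absGaloisOuterConj K g σ • P) = σ • W.geomPointsOuterConj K g P := by
  rw [smul_geomPoints_eq_map_restrictScalars, smul_geomPoints_eq_map_restrictScalars,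
    geomPointsOuterConj_apply, geomPointsOuterConj_apply, Affine.Point.map_map, Affine.Point.map_map]
  refine congrArg (fun f : AlgebraicClosure K →ₐ[ℚ] AlgebraicClosure K ↦
    Affine.Point.map (W' := W) f P) ?_
  ext x
  exact absGaloisTransportRat_absGaloisOuterConj_smul g σ x

omit [Normal ℚ K] in
variable (K) in
/-- **The action of `ĝ` on `E[m] ⊆ E(K̄)`** (`geomPointsOuterConj` commutes with multiplication by
`m`). [cite: Howard2004HeegnerKolyvagin, §2.3] -/
def geomTorsionOuterConj (g : absoluteGaloisGroup ℚ) (m : ℤ) :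
    geomTorsion (W.baseChange K) m →+ geomTorsion (W.baseChange K) m :=
  ((W.geomPointsOuterConj K g).comp (geomTorsion (W.baseChange K) m).subtype).codRestrict
    (geomTorsion (W.baseChange K) m) fun P ↦ by
      have hP : m • (P : geomPoints (W.baseChange K)) = 0 := (mem_geomTorsion_iff _ m _).mp P.2
      rw [mem_geomTorsion_iff, AddMonoidHom.coe_comp, Function.comp_apply, AddSubgroup.coe_subtype,
        ← map_zsmul, hP, map_zero]

omit [Normal ℚ K] in
/-- Underlying point of `geomTorsionOuterConj`. [folklore] -/
@[simp]
theorem coe_geomTorsionOuterConj (g : absoluteGaloisGroup ℚ) (m : ℤ)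
    (P : geomTorsion (W.baseChange K) m) :
    ((W.geomTorsionOuterConj K g m P : geomTorsion (W.baseChange K) m) :
      geomPoints (W.baseChange K)) = W.geomPointsOuterConj K g P :=
  rfl

omit [Normal ℚ K] in
/-- `geomTorsionOuterConj` is an involution for `g² = 1`. [folklore] -/
theorem geomTorsionOuterConj_comp_self {g : absoluteGaloisGroup ℚ} (hg : g * g = 1) (m : ℤ) :
    (W.geomTorsionOuterConj K g m).comp (W.geomTorsionOuterConj K g m) = AddMonoidHom.id _ :=
  AddMonoidHom.ext fun P ↦ Subtype.ext
    (W.geomPointsOuterConj_geomPointsOuterConj_of_mul_self hg (P : geomPoints (W.baseChange K)))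

variable (K) in
/-- **The outer conjugation on `H¹(H, E[m])`** for a subgroup `H ≤ Γ_K` stable under `σ ↦ ĝ⁻¹ σ ĝ`
(`L = K̄^H` with `ĝ(L) = L`): the map induced on continuous cohomology by the compatible pair
`(ĝ⁻¹ (·) ĝ : H → H, ĝ : E[m] → E[m])` (the tree's `resH1Hom`). This is the "change of group"
isomorphism `H¹(L, T) ≅ H¹(L, Tw(T)) = H¹(L, T)` of Howard 2004, §2.3 for `T = E[m]`, `E/ℚ`; for
`g = τ` a complex conjugation it is the action of complex conjugation on `H¹(L, E[m])` (Gross 1991,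
§4: eigenspaces of complex conjugation on `H¹(K, E_p)`). An involution for `g² = 1`
(`outerConjH1_comp_self`). [cite: Howard2004HeegnerKolyvagin, §2.3] [cite: GrossLMS1991, §4] -/
def outerConjH1 (g : absoluteGaloisGroup ℚ) (H : Subgroup (absoluteGaloisGroup K))
    (hH : ∀ σ ∈ H, absGaloisOuterConj K g σ ∈ H) (m : ℤ) :
    (W.baseChange K).torsionH1Over m H →+ (W.baseChange K).torsionH1Over m H :=
  resH1Hom (absGaloisOuterConjSubgroup g H hH) (W.geomTorsionOuterConj K g m) fun x P ↦
    Subtype.ext (by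
      rw [coe_geomTorsionOuterConj, Subgroup.smul_def, Subgroup.smul_def,
        Literature.NumberTheory.EllipticCurves.AddSubgroup.torsionBy.coe_smul,
        Literature.NumberTheory.EllipticCurves.AddSubgroup.torsionBy.coe_smul, coe_geomTorsionOuterConj,
        absGaloisOuterConjSubgroup_apply_coe]
      exact W.geomPointsOuterConj_absGaloisOuterConj_smul g (x : absoluteGaloisGroup K)
        (P : geomPoints (W.baseChange K)))

/-- **`outerConjH1` is an involution** for `g² = 1` (functoriality `resH1Hom_comp`, `resH1Hom_id`).
[cite: Howard2004HeegnerKolyvagin, §2.3] -/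
theorem outerConjH1_comp_self {g : absoluteGaloisGroup ℚ} (hg : g * g = 1)
    (H : Subgroup (absoluteGaloisGroup K)) (hH : ∀ σ ∈ H, absGaloisOuterConj K g σ ∈ H) (m : ℤ) :
    (W.outerConjH1 K g H hH m).comp (W.outerConjH1 K g H hH m) = AddMonoidHom.id _ := by
  rw [outerConjH1, resH1Hom_comp,
    resH1Hom_congr (absGaloisOuterConjSubgroup_comp_self hg H hH)
      (W.geomTorsionOuterConj_comp_self hg m) _ (fun _ _ ↦ rfl), resH1Hom_id]

end OuterConjPoints

/-! ### Complex conjugation on the levels of an anticyclotomic tower -/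

section ComplexConjLayer

variable (W : WeierstrassCurve ℚ) {K : Type} [Field K] [NumberField K] [Normal ℚ K] {p : ℕ}
  [Fact p.Prime] (κ : ZpExtension K p)

/-- **Complex conjugation on `H¹(K_s, E[m])`** for `E/ℚ`, `κ` an anticyclotomic `ℤ_p`-extension of
`K` (normal over `ℚ`; imaginary quadratic in every application) and `c₀ ∈ Γ_ℚ ∖ res(Γ_K)` (a complex
conjugation, `exists_not_mem_range_absGaloisRestrict`): `outerConjH1` on the stable subgroup
`Gal(K̄/K_s) = κ.layerSubgroup s` (`ZpExtension.absGaloisOuterConj_mem_layerSubgroup_iff`).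
Howard 2004, §2.3 ("conjugation by `τ` induces an isomorphism on cohomology"); Bertolini 1995 and
Gross 1991, §4 (the `τ`-action on the Selmer groups of the anticyclotomic layers).
[cite: Howard2004HeegnerKolyvagin, §2.3] -/
def complexConjLayerH1 (hκ : κ.IsAnticyclotomic) {c₀ : absoluteGaloisGroup ℚ}
    (hc₀ : c₀ ∉ Set.range (absGaloisRestrict ℚ K)) (s : ℕ) (m : ℤ) :
    (W.baseChange K).torsionH1Over m (κ.layerSubgroup s) →+
      (W.baseChange K).torsionH1Over m (κ.layerSubgroup s) :=
  W.outerConjH1 K c₀ (κ.layerSubgroup s)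
    (fun σ hσ ↦ (ZpExtension.absGaloisOuterConj_mem_layerSubgroup_iff hκ hc₀ σ s).mpr hσ) m

/-- `complexConjLayerH1` is an involution when `c₀² = 1`. [cite: Howard2004HeegnerKolyvagin, §2.3] -/
theorem complexConjLayerH1_comp_self (hκ : κ.IsAnticyclotomic) {c₀ : absoluteGaloisGroup ℚ}
    (hc₀ : c₀ ∉ Set.range (absGaloisRestrict ℚ K)) (hc : c₀ * c₀ = 1) (s : ℕ) (m : ℤ) :
    (W.complexConjLayerH1 κ hκ hc₀ s m).comp (W.complexConjLayerH1 κ hκ hc₀ s m) =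
      AddMonoidHom.id _ :=
  W.outerConjH1_comp_self hc _ _ m

/-- **Complex conjugation on `∏_k H¹(K_s, E[p^k])`** (componentwise `complexConjLayerH1`), the
ambient of the compact Selmer group `S_p(E/K_s)`. [cite: Howard2004HeegnerKolyvagin, §2.3] -/
def complexConjLayerPi (hκ : κ.IsAnticyclotomic) {c₀ : absoluteGaloisGroup ℚ}
    (hc₀ : c₀ ∉ Set.range (absGaloisRestrict ℚ K)) (s : ℕ) :
    (W.baseChange K).torsionH1Pi p (κ.layerSubgroup s) →+
      (W.baseChange K).torsionH1Pi p (κ.layerSubgroup s) :=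
  AddMonoidHom.pi fun k ↦ (W.complexConjLayerH1 κ hκ hc₀ s ((p : ℤ) ^ k)).comp
    (Pi.evalAddMonoidHom (fun j : ℕ ↦ (W.baseChange K).torsionH1Over ((p : ℤ) ^ j)
      (κ.layerSubgroup s)) k)

/-- Components of `complexConjLayerPi`. [folklore] -/
@[simp]
theorem complexConjLayerPi_apply (hκ : κ.IsAnticyclotomic) {c₀ : absoluteGaloisGroup ℚ}
    (hc₀ : c₀ ∉ Set.range (absGaloisRestrict ℚ K)) (s : ℕ)
    (x : (W.baseChange K).torsionH1Pi p (κ.layerSubgroup s)) (k : ℕ) :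
    W.complexConjLayerPi κ hκ hc₀ s x k = W.complexConjLayerH1 κ hκ hc₀ s ((p : ℤ) ^ k) (x k) :=
  rfl

/-- `complexConjLayerPi` is an involution when `c₀² = 1`. [folklore] -/
theorem complexConjLayerPi_comp_self (hκ : κ.IsAnticyclotomic) {c₀ : absoluteGaloisGroup ℚ}
    (hc₀ : c₀ ∉ Set.range (absGaloisRestrict ℚ K)) (hc : c₀ * c₀ = 1) (s : ℕ) :
    (W.complexConjLayerPi κ hκ hc₀ s).comp (W.complexConjLayerPi κ hκ hc₀ s) = AddMonoidHom.id _ := by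
  ext x k
  rw [AddMonoidHom.comp_apply, complexConjLayerPi_apply, complexConjLayerPi_apply,
    ← AddMonoidHom.comp_apply, W.complexConjLayerH1_comp_self κ hκ hc₀ hc, AddMonoidHom.id_apply,
    AddMonoidHom.id_apply]

/-- **Complex conjugation on `(∏_k H¹(K_s, E[p^k])) ⊗ ℚ`**, `ℚ`-linear (base change of
`complexConjLayerPi`): the action on the ambient of `S_p(E/K_s) ⊗ ℚ_p` and of the universal-norm
and Mordell–Weil subspaces of Parts 2–3. Gross 1991, §1 (`E(K) ⊗ ℚ_p = E(K)^+ ⊕ E(K)^-`).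
[cite: Howard2004HeegnerKolyvagin, §2.3] [cite: GrossLMS1991, §1] -/
def ratComplexConjLayer (hκ : κ.IsAnticyclotomic) {c₀ : absoluteGaloisGroup ℚ}
    (hc₀ : c₀ ∉ Set.range (absGaloisRestrict ℚ K)) (s : ℕ) :
    (W.baseChange K).ratTorsionH1Pi p (κ.layerSubgroup s) →ₗ[ℚ]
      (W.baseChange K).ratTorsionH1Pi p (κ.layerSubgroup s) :=
  (W.complexConjLayerPi κ hκ hc₀ s).toIntLinearMap.baseChange ℚ

/-- `ratComplexConjLayer` on pure tensors. [folklore] -/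
@[simp]
theorem ratComplexConjLayer_tmul (hκ : κ.IsAnticyclotomic) {c₀ : absoluteGaloisGroup ℚ}
    (hc₀ : c₀ ∉ Set.range (absGaloisRestrict ℚ K)) (s : ℕ) (q : ℚ)
    (x : (W.baseChange K).torsionH1Pi p (κ.layerSubgroup s)) :
    W.ratComplexConjLayer κ hκ hc₀ s (q ⊗ₜ[ℤ] x) = q ⊗ₜ[ℤ] W.complexConjLayerPi κ hκ hc₀ s x :=
  rfl

/-- `ratComplexConjLayer` is an involution when `c₀² = 1`. [folklore] -/
theorem ratComplexConjLayer_comp_self (hκ : κ.IsAnticyclotomic) {c₀ : absoluteGaloisGroup ℚ}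
    (hc₀ : c₀ ∉ Set.range (absGaloisRestrict ℚ K)) (hc : c₀ * c₀ = 1) (s : ℕ) :
    (W.ratComplexConjLayer κ hκ hc₀ s).comp (W.ratComplexConjLayer κ hκ hc₀ s) = LinearMap.id := by
  refine LinearMap.ext fun v ↦ ?_
  induction v using TensorProduct.induction_on with
  | zero => rw [map_zero, map_zero]
  | tmul q x =>
    rw [LinearMap.comp_apply, ratComplexConjLayer_tmul, ratComplexConjLayer_tmul,
      ← AddMonoidHom.comp_apply, W.complexConjLayerPi_comp_self κ hκ hc₀ hc, AddMonoidHom.id_apply,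
      LinearMap.id_apply]
  | add v w hv hw => rw [map_add, map_add, hv, hw]

/-- **The `+`-eigenspace of complex conjugation** on `(∏_k H¹(K_s, E[p^k])) ⊗ ℚ` (kernel of `c - 1`).
At `s = 0` it contains `E(ℚ) ⊗ ℚ_p` (`rationalPointsRatSubspace`); Gross 1991, §1 (`E(K)^±`).
[cite: GrossLMS1991, §1] -/
def layerPlusSubspace (hκ : κ.IsAnticyclotomic) {c₀ : absoluteGaloisGroup ℚ}
    (hc₀ : c₀ ∉ Set.range (absGaloisRestrict ℚ K)) (s : ℕ) :
    Submodule ℚ ((W.baseChange K).ratTorsionH1Pi p (κ.layerSubgroup s)) :=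
  LinearMap.ker (W.ratComplexConjLayer κ hκ hc₀ s - LinearMap.id)

/-- **The `-`-eigenspace of complex conjugation** on `(∏_k H¹(K_s, E[p^k])) ⊗ ℚ` (kernel of `c + 1`).
Gross 1991, §1 (`E(K)^±`). [cite: GrossLMS1991, §1] -/
def layerMinusSubspace (hκ : κ.IsAnticyclotomic) {c₀ : absoluteGaloisGroup ℚ}
    (hc₀ : c₀ ∉ Set.range (absGaloisRestrict ℚ K)) (s : ℕ) :
    Submodule ℚ ((W.baseChange K).ratTorsionH1Pi p (κ.layerSubgroup s)) :=
  LinearMap.ker (W.ratComplexConjLayer κ hκ hc₀ s + LinearMap.id)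

/-- Membership in the `+`-eigenspace: `c v = v`. [folklore] -/
theorem mem_layerPlusSubspace_iff (hκ : κ.IsAnticyclotomic) {c₀ : absoluteGaloisGroup ℚ}
    (hc₀ : c₀ ∉ Set.range (absGaloisRestrict ℚ K)) (s : ℕ)
    (v : (W.baseChange K).ratTorsionH1Pi p (κ.layerSubgroup s)) :
    v ∈ W.layerPlusSubspace κ hκ hc₀ s ↔ W.ratComplexConjLayer κ hκ hc₀ s v = v := by
  rw [layerPlusSubspace, LinearMap.mem_ker, LinearMap.sub_apply, LinearMap.id_apply, sub_eq_zero]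

/-- Membership in the `-`-eigenspace: `c v = -v`. [folklore] -/
theorem mem_layerMinusSubspace_iff (hκ : κ.IsAnticyclotomic) {c₀ : absoluteGaloisGroup ℚ}
    (hc₀ : c₀ ∉ Set.range (absGaloisRestrict ℚ K)) (s : ℕ)
    (v : (W.baseChange K).ratTorsionH1Pi p (κ.layerSubgroup s)) :
    v ∈ W.layerMinusSubspace κ hκ hc₀ s ↔ W.ratComplexConjLayer κ hκ hc₀ s v = -v := by
  rw [layerMinusSubspace, LinearMap.mem_ker, LinearMap.add_apply, LinearMap.id_apply,
    add_eq_zero_iff_eq_neg]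

end ComplexConjLayer

end WeierstrassCurve
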